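import Literature.NumberTheory.Sieve.HeathBrownCubicUpperBoundWeights
import Literature.NumberTheory.Sieve.HeathBrownCubicTypeIIProofs
import Literature.NumberTheory.LFunctions.PrimeIdealTheoremProofs
import HarnessLib

/-!
# Heath-Brown's Lemma 3.6 from the corrected Lemma 7.1 (§7, pp. 41–42)

Pure-proof file (no definitions): the eleventh layer of the decomposition of **parity.S18**
(`Literature.NumberTheory.Sieve.setOf_prime_cube_add_two_mul_cube_infinite`) along D. R. Heath-Brown,
*Primes represented by `x³ + 2y³`*, Acta Math. 186 (2001), 1–84. It PROVES

* `HeathBrown2001_lemma_3_6_of_lemma_7_1 :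
    HeathBrown2001_lemma_7_1_normWeighted → HeathBrown2001_lemma_3_6`,
* `Literature.NumberTheory.Sieve.setOf_prime_cube_add_two_mul_cube_infinite_of_lemma_7_1` — parity.S18
  from Lemma 3.5, the corrected Lemma 7.1 and Lemmas 3.7, 3.8, 3.9, 3.10 (the prime ideal theorem being
  `primeIdealTheorem_holds`),

i.e. Heath-Brown's Lemma 3.6 ("`S_j(𝒜) + κS_j(ℬ) ≪ τη²X²/log X` for `j = 3, 5, 6, 7`", p. 14; "It is now a
straightforward matter to establish Lemma 3.6", pp. 41–42) from the corrected, ideal-weighted form of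
his upper-bound sieve Lemma 7.1 (`HeathBrownCubicUpperBound`). After this file the frontier of
parity.S18 (`setOf_prime_cube_add_two_mul_cube_infinite_of_lemmas`, `HeathBrownCubicTypeIIProofs`)
reads: Lemma 3.5, Lemma 7.1 (corrected), Lemmas 3.7–3.10 (Landau's prime ideal theorem being proved
in the tree, `primeIdealTheorem_holds`).

## The argument (p. 41, made explicit)

With `τ = (log log X)^{−ϖ}`, `η` in the range (2.1), `κ = σ₀η(3X)^{-1}`, `L = log X`:
* `S₃` (`S₃_piece_le`): the range `X^{1−τ} ≤ N(P) < X^{1+τ}`; only first-degree `P` contribute to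
  `𝒜` (Lemma 3.1), the sifting level is lowered to `X^{1/2}`, Lemma 7.1 is summed over dyadic blocks
  (`≤ 3L` of them), the window sum `∑ N(P)^{-1}` is `≪ τ` by Mertens, and for `ℬ` the `≤ 3(√b + 1)`
  prime ideals of degree `≥ 2` are bounded by `#ℬ^(K)_P ≤ C_ℬX³/N(P)`; `S₅` (`S₅_piece_le`) is the
  range `X^{3/2−τ} ≤ N(P) < 2X^{3/2}`, "entirely analogous".
* `S₆` (`S₆_piece_le`): indices `({P_1}, P_2)`, `P_2 ≺ P_1`, `X^{3/2−τ} < N(P_1P_2) < X^{3/2+τ}`, hence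
  `N(P_2) > X^{1/2}` (`S₆_index`); the good indices (both norms prime and distinct) are re-indexed by
  the ideal `P_1P_2` of square-free norm and bounded by Lemma 7.1 at level `X^{1/2}`, their reciprocal
  sum being `≤ ∑_{p_2} p_2^{-1} ∑_{X^{3/2−τ}/p_2 < p_1 ≤ X^{3/2+τ}/p_2} p_1^{-1} ≪ τ` (`S₆_good_sum_le`);
  the defective indices only matter for `ℬ` and have reciprocal sum `≪ L²X^{−1/15}`
  (`S₆_bad_sum_le`).
* `S₇` (`S₇_piece_le`): indices `({P_1, P_2}, P_3)`, `N(P_1P_2) < X^{1+τ}`, `N(P_1P_2P_3) > X^{3/2−τ}`,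
  hence `X^{1/2−2τ} < N(P_3) < X^{(1+τ)/2}` and `N(P_1P_2P_3) < X^{(3+3τ)/2}` (`S₇_index`); level
  `X^{1/2−2τ}`, reciprocal sum `≤ (∑ p^{-1})²·∑_{p_3} p_3^{-1} ≪ τ` (`S₇_good_sum_le`), defective part
  `≪ L²X^{−1/15}` (`S₇_bad_sum_le`).
* Assembly: the weight of the corrected Lemma 7.1 is `c_K(N(Q))/N(Q) ≤ 8, 64, 512` times `N(Q)^{-1}` on
  the relevant ideals (`HeathBrownCubicUpperBoundWeights`); the polynomially small terms are absorbed
  by `eventually_upperBound_params`; the final constant is `c₃ + c₅ + c₆ + c₇`, explicit in Lemma 7.1's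
  constant, `σ₀`, the Weber–Landau constant `C_ℬ` and the Mertens constant `K₁` (all fixed once `ϖ`
  and `σ₀` are).

Ties of the order `≺` (two distinct prime ideals of equal norm, which occur for `ℬ^(K)`, p. 13) are
part of the defective indices and are shown negligible, as the paper asserts on p. 42 ("prime ideals of
degree greater than 1 may occur … these contribute `O(X^{3−1/12})`, say").

## References

* D. R. Heath-Brown, *Primes represented by `x³ + 2y³`*, Acta Math. 186 (2001), 1–84: Lemma 3.6
  (p. 14), Lemma 7.1 (p. 39), §7 pp. 41–42. [cite: HeathBrownActa2001, Lemma 3.6]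
* G. Harman, *Prime-Detecting Sieves*, LMS Monographs 33, Princeton (2007), §13.2. [cite: Harman2007, §13.2]

## Mathlib / tree search

Mathlib: `Finset.card_eq_one`, `Finset.card_eq_two`, `Finset.prod_pair`, `Finset.filter_congr_decidable`,
`Real.sqrt_le_iff`, `Real.pow_rpow_inv_natCast`, `Filter.eventually_atTop`. Tree:
`HeathBrownCubicUpperBoundWeights` (this layer's tools), `HeathBrownCubicUpperBoundIdealTools`
(`sum_inv_absNorm_uIdeal_two_le`, `sum_pair_window_le`, `sum_pair_defect_le`, `sum_triple_defect_le`),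
`HeathBrownCubicUpperBoundTools` (`eventually_upperBound_params`, `exists_sum_primes_inv_window_le`,
`exists_countB_le`, `sum_inv_absNorm_window_le`, `UpieceWhere_eq`), `HeathBrownCubicSieveDecomposition`
(`S₃`, `S₅`, `S₆`, `S₇`, `HeathBrown2001_lemma_3_6`), `HeathBrownCubicUpperBound`
(`HeathBrown2001_lemma_7_1_normWeighted`), `HeathBrownCubicPrimes` (`singularProductPartial_pos`).
-/

noncomputable section

open Polynomial NumberField Finset Filter Topology Asymptotics
open scoped nonZeroDivisors

namespace Literature.NumberTheory.Sieve.CubicSieve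

open LFunctions.CubeRootTwoField CubicPrimes
open Literature.NumberTheory.LFunctions (idealNormCount)

/-- **Indices of `U^(1)` as pairs of primes (swapped order).** As `sum_inv_absNorm_uIdeal_one_le`, with
the covering pairs listed as `(P_2, P_1)`. [cite: HeathBrownActa2001, §7 p. 41] -/
theorem sum_inv_absNorm_uIdeal_one_le' (T : Finset (Finset (Ideal (𝓞 K)) × Ideal (𝓞 K)))
    (D : Finset (Ideal (𝓞 K) × Ideal (𝓞 K)))
    (hcover : ∀ t ∈ T, ∃ P₁, t.1 = {P₁} ∧ (t.2, P₁) ∈ D) :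
    ∑ t ∈ T, ((Ideal.absNorm (uIdeal t) : ℕ) : ℝ)⁻¹ ≤
      ∑ x ∈ D, ((Ideal.absNorm x.1 : ℕ) : ℝ)⁻¹ * ((Ideal.absNorm x.2 : ℕ) : ℝ)⁻¹ := by
  classical
  set φ : Ideal (𝓞 K) × Ideal (𝓞 K) → Finset (Ideal (𝓞 K)) × Ideal (𝓞 K) :=
    fun x => ({x.2}, x.1) with hφ
  have hsub : T ⊆ D.image φ := by
    intro t ht
    obtain ⟨P₁, h1, hD⟩ := hcover t ht
    refine mem_image.mpr ⟨(t.2, P₁), hD, ?_⟩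
    rw [hφ]
    ext <;> simp [h1]
  calc ∑ t ∈ T, ((Ideal.absNorm (uIdeal t) : ℕ) : ℝ)⁻¹
      ≤ ∑ t ∈ D.image φ, ((Ideal.absNorm (uIdeal t) : ℕ) : ℝ)⁻¹ :=
        sum_le_sum_of_subset_of_nonneg hsub fun _ _ _ => by positivity
    _ ≤ ∑ x ∈ D, ((Ideal.absNorm (uIdeal (φ x)) : ℕ) : ℝ)⁻¹ :=
        sum_image_le_of_nonneg fun _ _ => by positivity
    _ = _ := sum_congr rfl fun x _ => by
        rw [hφ]
        simp only [uIdeal, prod_singleton, map_mul, Nat.cast_mul, mul_inv, mul_comm]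

/-! ### The piece `S₆` (p. 41) -/

open scoped Classical in
/-- **The indices of `S₆`.** An index of `S₆` is `({P_1}, P_2)` with `P_2 ≺ P_1` nonzero primes,
`N(P_i) < X^{1−τ}`, `X^{3/2−τ} < N(P_1)N(P_2) < X^{3/2+τ}`; consequently `N(P_2) > X^{1/2}`
("`≤ ∑_{X^{1/2} < p_2 < X^{1−τ}} ∑_{X^{3/2−τ}/p_2 < p_1 < X^{3/2+τ}/p_2}`", p. 41).
[cite: HeathBrownActa2001, §7 p. 41] -/
theorem S₆_index {X τ : ℝ} (hX1 : 1 < X) {t : Finset (Ideal (𝓞 K)) × Ideal (𝓞 K)}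
    (ht : t ∈ (Upairs X τ 1).filter (fun t =>
      X ^ (3 / 2 - τ) < ((Ideal.absNorm (∏ P ∈ t.1, P) * Ideal.absNorm t.2 : ℕ) : ℝ) ∧
        ((Ideal.absNorm (∏ P ∈ t.1, P) * Ideal.absNorm t.2 : ℕ) : ℝ) < X ^ (3 / 2 + τ))) :
    ∃ P₁ : Ideal (𝓞 K), t.1 = {P₁} ∧ P₁.IsPrime ∧ P₁ ≠ ⊥ ∧ (Ideal.absNorm P₁ : ℝ) < X ^ (1 - τ) ∧
      t.2.IsPrime ∧ t.2 ≠ ⊥ ∧ X ^ (1 / 2 : ℝ) < (Ideal.absNorm t.2 : ℝ) ∧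
      Ideal.absNorm t.2 ≤ Ideal.absNorm P₁ ∧ (Ideal.absNorm t.2 : ℝ) < X ^ (1 - τ) ∧
      X ^ (3 / 2 - τ) < (Ideal.absNorm P₁ : ℝ) * Ideal.absNorm t.2 ∧
      (Ideal.absNorm P₁ : ℝ) * Ideal.absNorm t.2 < X ^ (3 / 2 + τ) ∧
      (Ideal.absNorm (uIdeal t) : ℝ) = (Ideal.absNorm P₁ : ℝ) * Ideal.absNorm t.2 := by
  classical
  have hX0 : 0 < X := by linarith
  rw [mem_filter] at ht
  obtain ⟨htU, hlo, hhi⟩ := ht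
  obtain ⟨hch, hsm, hlt, -⟩ := mem_Upairs_iff.mp htU
  obtain ⟨hsub, hcard, -⟩ := mem_chains_iff.mp hch
  obtain ⟨P₁, h1⟩ := card_eq_one.mp hcard
  have hP₁s : P₁ ∈ smallPrimes X τ := hsub (by rw [h1]; exact mem_singleton_self _)
  obtain ⟨hP₁p, hP₁0, -, hP₁hi⟩ := mem_smallPrimes_iff.mp hP₁s
  obtain ⟨hP₂p, hP₂0, -, hP₂hi⟩ := mem_smallPrimes_iff.mp hsm
  have hle : Ideal.absNorm t.2 ≤ Ideal.absNorm P₁ :=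
    (hlt P₁ (by rw [h1]; exact mem_singleton_self _)).absNorm_le
  have hprod : ∏ P ∈ t.1, P = P₁ := by rw [h1, prod_singleton]
  rw [hprod, Nat.cast_mul] at hlo hhi
  have hN2 : (0 : ℝ) ≤ Ideal.absNorm t.2 := Nat.cast_nonneg _
  have hhalf : X ^ (1 / 2 : ℝ) < (Ideal.absNorm t.2 : ℝ) := by
    have h1' : X ^ (3 / 2 - τ) < X ^ (1 - τ) * (Ideal.absNorm t.2 : ℝ) :=
      hlo.trans_le (mul_le_mul_of_nonneg_right hP₁hi.le hN2)
    have h2' : X ^ (3 / 2 - τ) = X ^ (1 - τ) * X ^ (1 / 2 : ℝ) := by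
      rw [← Real.rpow_add hX0]; ring_nf
    rw [h2'] at h1'
    exact lt_of_mul_lt_mul_left h1' (Real.rpow_nonneg hX0.le _)
  refine ⟨P₁, h1, hP₁p, hP₁0, hP₁hi, hP₂p, hP₂0, hhalf, hle, hP₂hi, hlo, hhi, ?_⟩
  rw [absNorm_uIdeal, hprod, Nat.cast_mul]

open scoped Classical in
/-- **The reciprocal sum over the good indices of `S₆` is `≪ τ`** (p. 41:
"`∑ (p_1p_2)^{-1} ≤ ∑_{X^{1/2}<p_2<X^{1−τ}} ∑_{X^{3/2−τ}/p_2<p_1<X^{3/2+τ}/p_2} (p_1p_2)^{-1} ≪ ∑_{p_2} p_2^{-1}τ ≪ τ`"):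
explicitly `≤ 72(1 + K₁)(2 + K₁) τ`, by Mertens windows of first-degree prime ideals.
[cite: HeathBrownActa2001, §7 p. 41] -/
theorem S₆_good_sum_le {X τ K₁ : ℝ} (hX : (2 : ℝ) ^ 15 ≤ X) (hτ0 : 0 < τ) (hτ2 : τ ≤ 1 / 2)
    (hτL : (Real.log X)⁻¹ ≤ τ) (hK₁ : 0 ≤ K₁)
    (hK : ∀ (lo hi : ℝ) (T : Finset ℕ), 2 ≤ lo → lo ≤ hi →
      (∀ p ∈ T, p.Prime ∧ lo < (p : ℝ) ∧ (p : ℝ) ≤ hi) →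
      ∑ p ∈ T, (p : ℝ)⁻¹ ≤ (Real.log (hi / lo) + K₁) / Real.log lo) :
    ∑ t ∈ ((Upairs X τ 1).filter (fun t =>
      X ^ (3 / 2 - τ) < ((Ideal.absNorm (∏ P ∈ t.1, P) * Ideal.absNorm t.2 : ℕ) : ℝ) ∧
        ((Ideal.absNorm (∏ P ∈ t.1, P) * Ideal.absNorm t.2 : ℕ) : ℝ) < X ^ (3 / 2 + τ))).filter UGood,
        ((Ideal.absNorm (uIdeal t) : ℕ) : ℝ)⁻¹ ≤ 72 * (1 + K₁) * (2 + K₁) * τ := by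
  classical
  set L := Real.log X with hL
  have hX16 : 16 ≤ X := le_trans (by norm_num) hX
  have hX1 : 1 < X := by linarith
  have hX0 : 0 < X := by linarith
  have hL10 : 10 ≤ L := ten_le_log hX
  have hL0 : 0 < L := by linarith
  obtain ⟨-, h4, h2⟩ := rpow_lower_bounds hX
  -- the first-degree primes of the range `[X^{1/2}, X^{1−τ})`
  set W := (primesNormIco (X ^ (1 / 2 : ℝ)) (X ^ (1 - τ))).filter
    (fun P => (Ideal.absNorm P).Prime) with hW
  have hWmem : ∀ P ∈ W, P.IsPrime ∧ P ≠ ⊥ ∧ (Ideal.absNorm P).Prime ∧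
      X ^ (1 / 2 : ℝ) ≤ (Ideal.absNorm P : ℝ) ∧ (Ideal.absNorm P : ℝ) < X ^ (1 - τ) := by
    intro P hP
    rw [hW, mem_filter, mem_primesNormIco_iff] at hP
    exact ⟨hP.1.1, hP.1.2.1, hP.2, hP.1.2.2.1, hP.1.2.2.2⟩
  set D := (W ×ˢ W).filter (fun x => X ^ (3 / 2 - τ) < (Ideal.absNorm x.1 : ℝ) * Ideal.absNorm x.2 ∧
      (Ideal.absNorm x.1 : ℝ) * Ideal.absNorm x.2 ≤ X ^ (3 / 2 + τ)) with hD
  set T₆ := (Upairs X τ 1).filter (fun t =>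
      X ^ (3 / 2 - τ) < ((Ideal.absNorm (∏ P ∈ t.1, P) * Ideal.absNorm t.2 : ℕ) : ℝ) ∧
        ((Ideal.absNorm (∏ P ∈ t.1, P) * Ideal.absNorm t.2 : ℕ) : ℝ) < X ^ (3 / 2 + τ)) with hT₆
  -- cover the good indices
  have hcover := sum_inv_absNorm_uIdeal_one_le' (T₆.filter UGood) D (fun t ht => by
    rw [mem_filter] at ht
    obtain ⟨hT, hg⟩ := ht
    rw [hT₆] at hT
    obtain ⟨P₁, h1, hP₁p, hP₁0, hP₁hi, hP₂p, hP₂0, hhalf, hle, hP₂hi, hlo, hhi, -⟩ := S₆_index hX1 hT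
    have hle' : (Ideal.absNorm t.2 : ℝ) ≤ Ideal.absNorm P₁ := by exact_mod_cast hle
    have hpr2 : (Ideal.absNorm t.2).Prime := hg.1 t.2 (mem_insert_self _ _)
    have hpr1 : (Ideal.absNorm P₁).Prime := hg.1 P₁ (by rw [h1]; simp)
    refine ⟨P₁, h1, ?_⟩
    rw [hD, mem_filter, mem_product]
    refine ⟨⟨?_, ?_⟩, by rw [mul_comm]; exact hlo, by rw [mul_comm]; exact hhi.le⟩
    · rw [hW, mem_filter, mem_primesNormIco_iff]
      exact ⟨⟨hP₂p, hP₂0, hhalf.le, hP₂hi⟩, hpr2⟩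
    · rw [hW, mem_filter, mem_primesNormIco_iff]
      exact ⟨⟨hP₁p, hP₁0, hhalf.le.trans hle', hP₁hi⟩, hpr1⟩)
  -- the fibred window bound
  have hpair := sum_pair_window_le hK hK₁ W W (fun P hP => ⟨(hWmem P hP).1, (hWmem P hP).2.1,
    (hWmem P hP).2.2.1⟩) (lmin := X ^ (1 / 2 : ℝ)) (A := X ^ (3 / 2 - τ)) (B := X ^ (3 / 2 + τ))
    (by linarith) (Real.rpow_le_rpow_of_exponent_le hX1.le (by linarith)) (fun P hP => by
      refine ⟨by linarith [(hWmem P hP).2.2.2.1, Real.rpow_pos_of_pos hX0 (1 / 2 : ℝ)], ?_⟩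
      calc X ^ (1 / 2 : ℝ) * (Ideal.absNorm P : ℝ) ≤ X ^ (1 / 2 : ℝ) * X ^ (1 - τ) :=
            mul_le_mul_of_nonneg_left (hWmem P hP).2.2.2.2.le (Real.rpow_nonneg hX0.le _)
        _ = X ^ (3 / 2 - τ) := by rw [← Real.rpow_add hX0]; ring_nf)
  -- evaluate the window factor: `3(log X^{2τ} + K₁)/log X^{1/2} ≤ (12 + 6K₁)τ`
  have hfac : 3 * ((Real.log (X ^ (3 / 2 + τ) / X ^ (3 / 2 - τ)) + K₁) / Real.log (X ^ (1 / 2 : ℝ))) ≤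
      (12 + 6 * K₁) * τ := by
    have hq : X ^ (3 / 2 + τ) / X ^ (3 / 2 - τ) = X ^ (2 * τ) := by
      rw [← Real.rpow_sub hX0]; ring_nf
    rw [hq, Real.log_rpow hX0, Real.log_rpow hX0, ← hL]
    rw [show 3 * ((2 * τ * L + K₁) / (1 / 2 * L)) = 12 * τ + 6 * (K₁ / L) by field_simp; ring]
    have : K₁ / L ≤ K₁ * τ := by
      rw [div_eq_mul_inv]; exact mul_le_mul_of_nonneg_left hτL hK₁
    linarith
  -- the outer sum: `∑_{W} N(P)^{-1} ≤ 12(1 + K₁)`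
  have hout : ∑ P ∈ W, ((Ideal.absNorm P : ℕ) : ℝ)⁻¹ ≤ 12 * (1 + K₁) := by
    have hlo2 : 2 ≤ X ^ (1 / 2 : ℝ) / 2 := by linarith
    have hw := sum_inv_absNorm_window_le hK (lo := X ^ (1 / 2 : ℝ) / 2) (hi := X ^ (1 - τ)) hlo2
      (by linarith [Real.rpow_le_rpow_of_exponent_le hX1.le (show (1 / 2 : ℝ) ≤ 1 - τ by linarith)])
      W (fun P hP => ⟨(hWmem P hP).1, (hWmem P hP).2.1, (hWmem P hP).2.2.1,
        by linarith [(hWmem P hP).2.2.2.1], (hWmem P hP).2.2.2.2.le⟩)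
    refine hw.trans ?_
    -- numerator `≤ L + K₁`, denominator `≥ L/4`
    have hnum : Real.log (X ^ (1 - τ) / (X ^ (1 / 2 : ℝ) / 2)) ≤ L := by
      rw [hL]
      refine Real.log_le_log (by positivity) ?_
      rw [div_le_iff₀ (by positivity)]
      calc X ^ (1 - τ) ≤ X ^ (1 : ℝ) := Real.rpow_le_rpow_of_exponent_le hX1.le (by linarith)
        _ = X := Real.rpow_one X
        _ ≤ X * (X ^ (1 / 2 : ℝ) / 2) := by
            have : (2 : ℝ) ≤ X ^ (1 / 2 : ℝ) / 2 := hlo2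
            nlinarith
    have hden : L / 4 ≤ Real.log (X ^ (1 / 2 : ℝ) / 2) := by
      have h14 : Real.log (X ^ (1 / 4 : ℝ)) = L / 4 := by rw [Real.log_rpow hX0]; ring
      rw [← h14]
      refine Real.log_le_log (by positivity) ?_
      rw [le_div_iff₀ (by norm_num)]
      calc X ^ (1 / 4 : ℝ) * 2 ≤ X ^ (1 / 4 : ℝ) * X ^ (1 / 4 : ℝ) :=
            mul_le_mul_of_nonneg_left h4 (Real.rpow_nonneg hX0.le _)
        _ = X ^ (1 / 2 : ℝ) := by rw [← Real.rpow_add hX0]; norm_num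
    have hnum0 : 0 ≤ Real.log (X ^ (1 - τ) / (X ^ (1 / 2 : ℝ) / 2)) + K₁ := by
      have : 0 ≤ Real.log (X ^ (1 - τ) / (X ^ (1 / 2 : ℝ) / 2)) := by
        refine Real.log_nonneg ?_
        rw [le_div_iff₀ (by positivity), one_mul]
        linarith [Real.rpow_le_rpow_of_exponent_le hX1.le (show (1 / 2 : ℝ) ≤ 1 - τ by linarith)]
      linarith
    calc 3 * ((Real.log (X ^ (1 - τ) / (X ^ (1 / 2 : ℝ) / 2)) + K₁) / Real.log (X ^ (1 / 2 : ℝ) / 2))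
        ≤ 3 * ((L + K₁) / (L / 4)) := by
          gcongr 3 * ?_
          exact div_le_div₀ (by linarith) (by linarith) (by positivity) hden
      _ = 12 * (1 + K₁ / L) := by field_simp; ring
      _ ≤ 12 * (1 + K₁) := by
          have : K₁ / L ≤ K₁ := div_le_self hK₁ (by linarith)
          linarith
  have hfac0 : 0 ≤ 3 * ((Real.log (X ^ (3 / 2 + τ) / X ^ (3 / 2 - τ)) + K₁) / Real.log (X ^ (1 / 2 : ℝ))) := by
    have hq : X ^ (3 / 2 + τ) / X ^ (3 / 2 - τ) = X ^ (2 * τ) := by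
      rw [← Real.rpow_sub hX0]; ring_nf
    rw [hq, Real.log_rpow hX0, Real.log_rpow hX0, ← hL]
    positivity
  calc _ ≤ _ := hcover
    _ ≤ (∑ P ∈ W, ((Ideal.absNorm P : ℕ) : ℝ)⁻¹) *
          (3 * ((Real.log (X ^ (3 / 2 + τ) / X ^ (3 / 2 - τ)) + K₁) / Real.log (X ^ (1 / 2 : ℝ)))) := hpair
    _ ≤ (12 * (1 + K₁)) * ((12 + 6 * K₁) * τ) :=
        mul_le_mul hout hfac hfac0 (by positivity)
    _ = 72 * (1 + K₁) * (2 + K₁) * τ := by ring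

open scoped Classical in
/-- **The reciprocal sum over the defective indices of `S₆(ℬ)` is negligible**:
`≤ 90 (log X)² X^{−1/15}` (both primes have norm `> X^{1/2} > X^{1/5}`; `sum_pair_defect_le`).
[cite: HeathBrownActa2001, §7 p. 42] -/
theorem S₆_bad_sum_le {X τ : ℝ} (hX : (2 : ℝ) ^ 15 ≤ X) (hτ0 : 0 ≤ τ) :
    ∑ t ∈ ((Upairs X τ 1).filter (fun t =>
      X ^ (3 / 2 - τ) < ((Ideal.absNorm (∏ P ∈ t.1, P) * Ideal.absNorm t.2 : ℕ) : ℝ) ∧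
        ((Ideal.absNorm (∏ P ∈ t.1, P) * Ideal.absNorm t.2 : ℕ) : ℝ) < X ^ (3 / 2 + τ))).filter
          (fun t => ¬ UGood t),
        ((Ideal.absNorm (uIdeal t) : ℕ) : ℝ)⁻¹ ≤ 90 * Real.log X ^ 2 * X ^ (-(1 / 15 : ℝ)) := by
  classical
  set L := Real.log X with hL
  have hX16 : 16 ≤ X := le_trans (by norm_num) hX
  have hX1 : 1 < X := by linarith
  have hX0 : 0 < X := by linarith
  have hL10 : 10 ≤ L := ten_le_log hX
  have hL1 : 1 ≤ L := by linarith
  obtain ⟨h8, -, -⟩ := rpow_lower_bounds hX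
  have h15 : X ^ (1 / 5 : ℝ) < X ^ (1 / 2 : ℝ) := Real.rpow_lt_rpow_of_exponent_lt hX1 (by norm_num)
  set V := primesNormIco (X ^ (1 / 2 : ℝ)) (X ^ (1 - τ)) with hV
  have hVmem : ∀ P ∈ V, P.IsPrime ∧ P ≠ ⊥ ∧ X ^ (1 / 5 : ℝ) < (Ideal.absNorm P : ℝ) ∧
      (Ideal.absNorm P : ℝ) ≤ X := by
    intro P hP
    rw [hV, mem_primesNormIco_iff] at hP
    refine ⟨hP.1, hP.2.1, h15.trans_le hP.2.2.1, hP.2.2.2.le.trans ?_⟩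
    calc X ^ (1 - τ) ≤ X ^ (1 : ℝ) := Real.rpow_le_rpow_of_exponent_le hX1.le (by linarith)
      _ = X := Real.rpow_one X
  set D := (V ×ˢ V).filter (fun p => ¬ (Ideal.absNorm p.1).Prime ∨ ¬ (Ideal.absNorm p.2).Prime ∨
      Ideal.absNorm p.1 = Ideal.absNorm p.2) with hD
  set T₆ := (Upairs X τ 1).filter (fun t =>
      X ^ (3 / 2 - τ) < ((Ideal.absNorm (∏ P ∈ t.1, P) * Ideal.absNorm t.2 : ℕ) : ℝ) ∧
        ((Ideal.absNorm (∏ P ∈ t.1, P) * Ideal.absNorm t.2 : ℕ) : ℝ) < X ^ (3 / 2 + τ)) with hT₆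
  have hcover := sum_inv_absNorm_uIdeal_one_le' (T₆.filter fun t => ¬ UGood t) D (fun t ht => by
    rw [mem_filter] at ht
    obtain ⟨hT, hg⟩ := ht
    rw [hT₆] at hT
    obtain ⟨P₁, h1, hP₁p, hP₁0, hP₁hi, hP₂p, hP₂0, hhalf, hle, hP₂hi, -, -, -⟩ := S₆_index hX1 hT
    have hle' : (Ideal.absNorm t.2 : ℝ) ≤ Ideal.absNorm P₁ := by exact_mod_cast hle
    refine ⟨P₁, h1, ?_⟩
    rw [hD, mem_filter, mem_product]
    refine ⟨⟨?_, ?_⟩, ?_⟩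
    · rw [hV, mem_primesNormIco_iff]; exact ⟨hP₂p, hP₂0, hhalf.le, hP₂hi⟩
    · rw [hV, mem_primesNormIco_iff]; exact ⟨hP₁p, hP₁0, hhalf.le.trans hle', hP₁hi⟩
    · -- translate `¬ UGood t`
      unfold UGood at hg
      rw [h1, not_and_or] at hg
      rcases hg with hg | hg
      · push Not at hg
        obtain ⟨P, hP, hnp⟩ := hg
        simp only [mem_insert, mem_singleton] at hP
        rcases hP with rfl | rfl
        · exact Or.inl hnp
        · exact Or.inr (Or.inl hnp)
      · rw [Set.InjOn] at hg
        push Not at hg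
        obtain ⟨a, ha, b, hb, hab, hne⟩ := hg
        simp only [coe_insert, coe_singleton, Set.mem_insert_iff, Set.mem_singleton_iff] at ha hb
        right; right
        rcases ha with rfl | rfl <;> rcases hb with rfl | rfl
        · exact absurd rfl hne
        · exact hab
        · exact hab.symm
        · exact absurd rfl hne)
  have hdef := sum_pair_defect_le (Y := X ^ (1 / 5 : ℝ)) (x := X) h8 hX1.le V hVmem
  -- simplify the bound
  have hY3 : (X ^ (1 / 5 : ℝ)) ^ (1 / 3 : ℝ) = X ^ (1 / 15 : ℝ) := by
    rw [← Real.rpow_mul hX0.le]; norm_num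
  have h1 : 6 / (X ^ (1 / 5 : ℝ)) ^ (1 / 3 : ℝ) = 6 * X ^ (-(1 / 15 : ℝ)) := by
    rw [hY3, Real.rpow_neg hX0.le, div_eq_mul_inv]
  have h2 : 18 / X ^ (1 / 5 : ℝ) ≤ 18 * X ^ (-(1 / 15 : ℝ)) := by
    rw [div_eq_mul_inv, ← Real.rpow_neg hX0.le]
    exact mul_le_mul_of_nonneg_left (Real.rpow_le_rpow_of_exponent_le hX1.le (by norm_num)) (by norm_num)
  have hXp : 0 ≤ X ^ (-(1 / 15 : ℝ)) := Real.rpow_nonneg hX0.le _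
  have hlogX : Real.log X = L := rfl
  calc _ ≤ _ := hcover
    _ ≤ 2 * (6 / (X ^ (1 / 5 : ℝ)) ^ (1 / 3 : ℝ)) * (3 * (1 + Real.log X)) + 18 / X ^ (1 / 5 : ℝ) := hdef
    _ ≤ 2 * (6 * X ^ (-(1 / 15 : ℝ))) * (3 * (1 + L)) + 18 * X ^ (-(1 / 15 : ℝ)) := by rw [h1]; linarith
    _ = (54 + 36 * L) * X ^ (-(1 / 15 : ℝ)) := by ring
    _ ≤ (90 * L ^ 2) * X ^ (-(1 / 15 : ℝ)) := by
        refine mul_le_mul_of_nonneg_right ?_ hXp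
        nlinarith
    _ = 90 * L ^ 2 * X ^ (-(1 / 15 : ℝ)) := by ring

open scoped Classical in
/-- **`S₆(𝒜) + κS₆(ℬ) ≪ τη²X²/log X`** (p. 41), from the corrected Lemma 7.1 in weighted form (`h7A`,
`h7B`, weight `w ≤ 64/N` on products of two distinct first-degree primes), via `uPiece_pair_le` with
level `X^{1/2}`, range `(X^{3/2−τ}, X^{3/2+τ})`, `min(z, X^{2−τ}/b) ≥ X^{1/4}`, and the sums
`S₆_good_sum_le`, `S₆_bad_sum_le`. [cite: HeathBrownActa2001, §7 p. 41] -/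
theorem S₆_piece_le {X η τ σ₀ C₇ C_B K₁ : ℝ} {w : Ideal (𝓞 K) → ℝ}
    (hX : (2 : ℝ) ^ 15 ≤ X) (hτ0 : 0 < τ) (hτ8 : τ ≤ 1 / 8) (hτL : (Real.log X)⁻¹ ≤ τ)
    (hη0 : 0 < η) (hη1 : η ≤ 1) (hσ0 : 0 ≤ σ₀) (hC₇ : 0 ≤ C₇) (hCB : 0 ≤ C_B) (hK₁ : 0 ≤ K₁)
    (habs : X ^ (-τ / 5) * Real.log X ^ 3 ≤ τ * η ^ 2 / Real.log X)
    (hK : ∀ (lo hi : ℝ) (T : Finset ℕ), 2 ≤ lo → lo ≤ hi →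
      (∀ p ∈ T, p.Prime ∧ lo < (p : ℝ) ∧ (p : ℝ) ≤ hi) →
      ∑ p ∈ T, (p : ℝ)⁻¹ ≤ (Real.log (hi / lo) + K₁) / Real.log lo)
    (hw0 : ∀ Q, 0 ≤ w Q)
    (hwU : ∀ (n : ℕ) (t : Finset (Ideal (𝓞 K)) × Ideal (𝓞 K)), t ∈ Upairs X τ n → UGood t →
      w (uIdeal t) ≤ 8 ^ (n + 1) * ((Ideal.absNorm (uIdeal t) : ℕ) : ℝ)⁻¹)
    (h7A : ∀ (N z : ℝ) (𝒮 : Finset (Ideal (𝓞 K))), X ^ τ ≤ z → 0 < N → N ≤ X ^ (2 - 2 * τ) →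
        (∀ Q ∈ 𝒮, Squarefree (Ideal.absNorm Q) ∧ N < (Ideal.absNorm Q : ℝ) ∧
          (Ideal.absNorm Q : ℝ) ≤ 2 * N) →
        ∑ Q ∈ 𝒮, (siftedA X η Q z : ℝ) ≤
          C₇ * (η ^ 2 * X ^ 2 / Real.log (min z (X ^ (2 - τ) / N)) * ∑ Q ∈ 𝒮, w Q + X ^ (2 - τ / 5)))
    (h7B : ∀ (N z : ℝ) (𝒮 : Finset (Ideal (𝓞 K))), X ^ τ ≤ z → 0 < N → N ≤ X ^ (2 - 2 * τ) →
        (∀ Q ∈ 𝒮, Squarefree (Ideal.absNorm Q) ∧ N < (Ideal.absNorm Q : ℝ) ∧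
          (Ideal.absNorm Q : ℝ) ≤ 2 * N) →
        ∑ Q ∈ 𝒮, (siftedB X η Q z : ℝ) ≤
          C₇ * (η * X ^ 3 / Real.log (min z (X ^ (2 - τ) / N)) * ∑ Q ∈ 𝒮, w Q + X ^ (3 - τ / 5)))
    (hcountB : ∀ R : Ideal (𝓞 K), R ≠ ⊥ → (countB X η R : ℝ) ≤ C_B * X ^ 3 / Ideal.absNorm R) :
    (S₆ (boxPairs X η) pairIdeal X τ : ℝ) + kappa σ₀ X η * S₆ (normWindow X η) (fun J => J) X τ ≤
      (C₇ * 64 * (72 * (1 + K₁) * (2 + K₁)) / (1 / 4) + 3 * C₇ +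
          σ₀ * C₇ * 64 * (72 * (1 + K₁) * (2 + K₁)) / (3 * (1 / 4)) + σ₀ * C₇ + σ₀ * C_B * 90 / 3) *
        (τ * η ^ 2 * X ^ 2 / Real.log X) := by
  classical
  have hX16 : 16 ≤ X := le_trans (by norm_num) hX
  have hX1 : 1 < X := by linarith
  have hX0 : 0 < X := by linarith
  obtain ⟨-, h4, h2⟩ := rpow_lower_bounds hX
  set T₆ := (Upairs X τ 1).filter (fun t =>
      X ^ (3 / 2 - τ) < ((Ideal.absNorm (∏ P ∈ t.1, P) * Ideal.absNorm t.2 : ℕ) : ℝ) ∧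
        ((Ideal.absNorm (∏ P ∈ t.1, P) * Ideal.absNorm t.2 : ℕ) : ℝ) < X ^ (3 / 2 + τ)) with hT₆
  have hSA : (S₆ (boxPairs X η) pairIdeal X τ : ℝ) =
      ∑ t ∈ T₆, (famSiftedAbove (boxPairs X η) pairIdeal (uIdeal t) t.2 : ℝ) := by
    rw [S₆, UpieceWhere_eq, Nat.cast_sum]
    exact Finset.sum_congr (by rw [hT₆]; exact Finset.filter_congr_decidable _ _ _ ) fun _ _ => rfl
  have hSB : (S₆ (normWindow X η) (fun J => J) X τ : ℝ) =
      ∑ t ∈ T₆, (famSiftedAbove (normWindow X η) (fun J => J) (uIdeal t) t.2 : ℝ) := by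
    rw [S₆, UpieceWhere_eq, Nat.cast_sum]
    exact Finset.sum_congr (by rw [hT₆]; exact Finset.filter_congr_decidable _ _ _ ) fun _ _ => rfl
  rw [hSA, hSB]
  have hT : T₆ ⊆ Upairs X τ 1 := filter_subset _ _
  -- parameters of `uPiece_pair_le`
  have hzτ : X ^ τ ≤ X ^ (1 / 2 : ℝ) := Real.rpow_le_rpow_of_exponent_le hX1.le (by linarith)
  have ha2 : 2 ≤ X ^ (3 / 2 - τ) := by
    calc (2 : ℝ) ≤ X ^ (1 : ℝ) := by rw [Real.rpow_one]; linarith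
      _ ≤ X ^ (3 / 2 - τ) := Real.rpow_le_rpow_of_exponent_le hX1.le (by linarith)
  have hab : X ^ (3 / 2 - τ) ≤ X ^ (3 / 2 + τ) := Real.rpow_le_rpow_of_exponent_le hX1.le (by linarith)
  have hb : X ^ (3 / 2 + τ) ≤ X ^ (2 - 2 * τ) := Real.rpow_le_rpow_of_exponent_le hX1.le (by linarith)
  have hb2 : X ^ (3 / 2 + τ) ≤ X ^ 2 := by
    calc X ^ (3 / 2 + τ) ≤ X ^ (2 : ℝ) := Real.rpow_le_rpow_of_exponent_le hX1.le (by linarith)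
      _ = X ^ 2 := Real.rpow_two X
  have hmin : X ^ (1 / 4 : ℝ) ≤ min (X ^ (1 / 2 : ℝ)) (X ^ (2 - τ) / X ^ (3 / 2 + τ)) := by
    refine le_min (Real.rpow_le_rpow_of_exponent_le hX1.le (by norm_num)) ?_
    rw [← Real.rpow_sub hX0]
    exact Real.rpow_le_rpow_of_exponent_le hX1.le (by linarith)
  have hz : ∀ t ∈ T₆, X ^ (1 / 2 : ℝ) ≤ Ideal.absNorm t.2 := by
    intro t ht
    rw [hT₆] at ht
    obtain ⟨_, -, -, -, -, -, -, hhalf, -⟩ := S₆_index hX1 ht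
    exact hhalf.le
  have hrange : ∀ t ∈ T₆, X ^ (3 / 2 - τ) ≤ (Ideal.absNorm (uIdeal t) : ℝ) ∧
      (Ideal.absNorm (uIdeal t) : ℝ) < X ^ (3 / 2 + τ) := by
    intro t ht
    rw [hT₆] at ht
    obtain ⟨P₁, -, -, -, -, -, -, -, -, -, hlo, hhi, hN⟩ := S₆_index hX1 ht
    rw [hN]
    exact ⟨hlo.le, hhi⟩
  have hgood := S₆_good_sum_le hX hτ0 (by linarith) hτL hK₁ hK
  have hbad := S₆_bad_sum_le (τ := τ) hX hτ0.le
  have h := uPiece_pair_le (n := 1) (cm := 1 / 4) (mU := 64) (Wc := 72 * (1 + K₁) * (2 + K₁)) (Wb := 90)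
    hX hη0 hη1 hσ0 hC₇ hCB (by norm_num) (by norm_num) (by norm_num) (by linarith) habs hw0 h7A h7B
    hcountB T₆ hT (fun t ht hg => by have := hwU 1 t (hT ht) hg; norm_num at this; exact this)
    hzτ hz ha2 hab hb hb2 hmin hrange hgood hbad
  exact h

/-! ### The piece `S₇` (p. 41) -/

/-- `X^{1/8} ≥ 2` and `X^{1/4} ≥ 8` for `X ≥ 2^{15}`. [folklore] -/
theorem rpow_lower_bounds' {X : ℝ} (hX : (2 : ℝ) ^ 15 ≤ X) :
    2 ≤ X ^ (1 / 8 : ℝ) ∧ 8 ≤ X ^ (1 / 4 : ℝ) := by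
  have h256 : (256 : ℝ) ≤ X := le_trans (by norm_num) hX
  have h4096 : (4096 : ℝ) ≤ X := le_trans (by norm_num) hX
  refine ⟨?_, ?_⟩
  · calc (2 : ℝ) = ((2 : ℝ) ^ 8) ^ ((8 : ℕ) : ℝ)⁻¹ := by
          rw [Real.pow_rpow_inv_natCast (by norm_num) (by norm_num)]
      _ = (256 : ℝ) ^ (1 / 8 : ℝ) := by norm_num
      _ ≤ X ^ (1 / 8 : ℝ) := Real.rpow_le_rpow (by norm_num) h256 (by norm_num)
  · calc (8 : ℝ) = ((8 : ℝ) ^ 4) ^ ((4 : ℕ) : ℝ)⁻¹ := by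
          rw [Real.pow_rpow_inv_natCast (by norm_num) (by norm_num)]
      _ = (4096 : ℝ) ^ (1 / 4 : ℝ) := by norm_num
      _ ≤ X ^ (1 / 4 : ℝ) := Real.rpow_le_rpow (by norm_num) h4096 (by norm_num)

open scoped Classical in
/-- **The indices of `S₇`.** An index of `S₇` is `({P_1, P_2}, P_3)` with `P_3 ≺ P_1, P_2` nonzero
primes, `N(P_i) < X^{1−τ}`, `N(P_1P_2) < X^{1+τ}`, `N(P_1P_2P_3) > X^{3/2−τ}`; consequently
`N(P_3) > X^{1/2−2τ}`, `N(P_3) < X^{(1+τ)/2}` and `N(P_1P_2P_3) < X^{(3+3τ)/2}` (p. 41: "the summation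
conditions for `S₇` imply `N(P_3) = N(P_1P_2P_3)/N(P_1P_2) > X^{1/2−2τ}` and `N(P_3) ≤ N(P_1P_2)^{1/2}`").
[cite: HeathBrownActa2001, §7 p. 41] -/
theorem S₇_index {X τ : ℝ} (hX1 : 1 < X) {t : Finset (Ideal (𝓞 K)) × Ideal (𝓞 K)}
    (ht : t ∈ (Upairs X τ 2).filter (fun t =>
      X ^ (3 / 2 - τ) < ((Ideal.absNorm (∏ P ∈ t.1, P) * Ideal.absNorm t.2 : ℕ) : ℝ))) :
    ∃ P₁ P₂ : Ideal (𝓞 K), P₁ ≠ P₂ ∧ t.1 = {P₁, P₂} ∧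
      P₁.IsPrime ∧ P₁ ≠ ⊥ ∧ (Ideal.absNorm P₁ : ℝ) < X ^ (1 - τ) ∧
      P₂.IsPrime ∧ P₂ ≠ ⊥ ∧ (Ideal.absNorm P₂ : ℝ) < X ^ (1 - τ) ∧
      t.2.IsPrime ∧ t.2 ≠ ⊥ ∧ X ^ (1 / 2 - 2 * τ) < (Ideal.absNorm t.2 : ℝ) ∧
      Ideal.absNorm t.2 ≤ Ideal.absNorm P₁ ∧ Ideal.absNorm t.2 ≤ Ideal.absNorm P₂ ∧
      (Ideal.absNorm t.2 : ℝ) < X ^ ((1 + τ) / 2) ∧ (Ideal.absNorm t.2 : ℝ) < X ^ (1 - τ) ∧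
      X ^ (3 / 2 - τ) < (Ideal.absNorm P₁ : ℝ) * Ideal.absNorm P₂ * Ideal.absNorm t.2 ∧
      (Ideal.absNorm P₁ : ℝ) * Ideal.absNorm P₂ * Ideal.absNorm t.2 < X ^ ((3 + 3 * τ) / 2) ∧
      (Ideal.absNorm (uIdeal t) : ℝ) = (Ideal.absNorm P₁ : ℝ) * Ideal.absNorm P₂ * Ideal.absNorm t.2 := by
  classical
  have hX0 : 0 < X := by linarith
  rw [mem_filter] at ht
  obtain ⟨htU, hlo⟩ := ht
  obtain ⟨hch, hsm, hlt, -⟩ := mem_Upairs_iff.mp htU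
  obtain ⟨hsub, hcard, hch3⟩ := mem_chains_iff.mp hch
  obtain ⟨P₁, P₂, hne, h12⟩ := card_eq_two.mp hcard
  have hP₁s : P₁ ∈ smallPrimes X τ := hsub (by rw [h12]; simp)
  have hP₂s : P₂ ∈ smallPrimes X τ := hsub (by rw [h12]; simp)
  obtain ⟨hP₁p, hP₁0, -, hP₁hi⟩ := mem_smallPrimes_iff.mp hP₁s
  obtain ⟨hP₂p, hP₂0, -, hP₂hi⟩ := mem_smallPrimes_iff.mp hP₂s
  obtain ⟨hP₃p, hP₃0, -, hP₃hi⟩ := mem_smallPrimes_iff.mp hsm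
  have hle1 : Ideal.absNorm t.2 ≤ Ideal.absNorm P₁ := (hlt P₁ (by rw [h12]; simp)).absNorm_le
  have hle2 : Ideal.absNorm t.2 ≤ Ideal.absNorm P₂ := (hlt P₂ (by rw [h12]; simp)).absNorm_le
  have hprod : ∏ P ∈ t.1, P = P₁ * P₂ := by rw [h12, prod_pair hne]
  rw [hprod, map_mul, Nat.cast_mul, Nat.cast_mul] at hlo
  rw [hprod, map_mul, Nat.cast_mul] at hch3
  have hle1' : (Ideal.absNorm t.2 : ℝ) ≤ Ideal.absNorm P₁ := by exact_mod_cast hle1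
  have hle2' : (Ideal.absNorm t.2 : ℝ) ≤ Ideal.absNorm P₂ := by exact_mod_cast hle2
  set N₁ : ℝ := (Ideal.absNorm P₁ : ℝ) with hN₁
  set N₂ : ℝ := (Ideal.absNorm P₂ : ℝ) with hN₂
  set N₃ : ℝ := (Ideal.absNorm t.2 : ℝ) with hN₃
  have hN1 : 0 ≤ N₁ := Nat.cast_nonneg _
  have hN2 : 0 ≤ N₂ := Nat.cast_nonneg _
  have hN3 : 0 ≤ N₃ := Nat.cast_nonneg _
  -- `N₃ > X^{1/2 − 2τ}`
  have hz : X ^ (1 / 2 - 2 * τ) < N₃ := by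
    have h1' : X ^ (3 / 2 - τ) < X ^ (1 + τ) * N₃ :=
      hlo.trans_le (mul_le_mul_of_nonneg_right hch3.le hN3)
    have h2' : X ^ (3 / 2 - τ) = X ^ (1 + τ) * X ^ (1 / 2 - 2 * τ) := by
      rw [← Real.rpow_add hX0]; ring_nf
    rw [h2'] at h1'
    exact lt_of_mul_lt_mul_left h1' (Real.rpow_nonneg hX0.le _)
  -- `N₃ < X^{(1+τ)/2}`
  have hhalf : N₃ < X ^ ((1 + τ) / 2) := by
    by_contra h
    push Not at h
    have hsq : X ^ ((1 + τ) / 2) * X ^ ((1 + τ) / 2) ≤ N₃ * N₃ :=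
      mul_le_mul h h (Real.rpow_nonneg hX0.le _) hN3
    rw [← Real.rpow_add hX0, show (1 + τ) / 2 + (1 + τ) / 2 = 1 + τ by ring] at hsq
    have : N₃ * N₃ ≤ N₁ * N₂ := mul_le_mul hle1' hle2' hN3 hN1
    linarith
  have hupper : N₁ * N₂ * N₃ < X ^ ((3 + 3 * τ) / 2) := by
    have h' : X ^ ((3 + 3 * τ) / 2) = X ^ (1 + τ) * X ^ ((1 + τ) / 2) := by
      rw [← Real.rpow_add hX0]; ring_nf
    rw [h']
    exact mul_lt_mul'' hch3 hhalf (mul_nonneg hN1 hN2) hN3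
  refine ⟨P₁, P₂, hne, h12, hP₁p, hP₁0, hP₁hi, hP₂p, hP₂0, hP₂hi, hP₃p, hP₃0, hz, hle1, hle2, hhalf,
    hP₃hi, hlo, hupper, ?_⟩
  rw [absNorm_uIdeal, hprod, map_mul, Nat.cast_mul, Nat.cast_mul]

/-- Triple sums over `A × B × C` of a product of one-variable weights factor. [folklore] -/
theorem sum_triple_mul_eq' (A B C : Finset (Ideal (𝓞 K))) (f g h : Ideal (𝓞 K) → ℝ) :
    ∑ p ∈ A ×ˢ (B ×ˢ C), f p.1 * g p.2.1 * h p.2.2 =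
      (∑ P ∈ A, f P) * (∑ P ∈ B, g P) * (∑ P ∈ C, h P) := by
  rw [sum_product, mul_assoc, sum_mul]
  refine sum_congr rfl fun x _ => ?_
  rw [sum_product, sum_mul_sum, mul_sum]
  refine sum_congr rfl fun y _ => ?_
  rw [mul_sum]
  exact sum_congr rfl fun _ _ => by ring

open scoped Classical in
/-- **The reciprocal sum over the good indices of `S₇` is `≪ τ`** (p. 41: "We thus have a sum over
`(p_1p_2p_3)^{-1}` in which `X^{1/2−2τ} < p_2, p_1 < X^{1−τ}` and `X^{1/2−2τ} < p_3 < X^{1/2+τ/2}`. This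
therefore produces a total `O(τ)`"): explicitly `≤ (24(1 + K₁))²·24(4 + K₁)·τ`.
[cite: HeathBrownActa2001, §7 p. 41] -/
theorem S₇_good_sum_le {X τ K₁ : ℝ} (hX : (2 : ℝ) ^ 15 ≤ X) (hτ0 : 0 < τ) (hτ8 : τ ≤ 1 / 8)
    (hτL : (Real.log X)⁻¹ ≤ τ) (hK₁ : 0 ≤ K₁)
    (hK : ∀ (lo hi : ℝ) (T : Finset ℕ), 2 ≤ lo → lo ≤ hi →
      (∀ p ∈ T, p.Prime ∧ lo < (p : ℝ) ∧ (p : ℝ) ≤ hi) →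
      ∑ p ∈ T, (p : ℝ)⁻¹ ≤ (Real.log (hi / lo) + K₁) / Real.log lo) :
    ∑ t ∈ ((Upairs X τ 2).filter (fun t =>
      X ^ (3 / 2 - τ) < ((Ideal.absNorm (∏ P ∈ t.1, P) * Ideal.absNorm t.2 : ℕ) : ℝ))).filter UGood,
        ((Ideal.absNorm (uIdeal t) : ℕ) : ℝ)⁻¹ ≤
      (24 * (1 + K₁)) ^ 2 * (24 * (4 + K₁)) * τ := by
  classical
  set L := Real.log X with hL
  have hX16 : 16 ≤ X := le_trans (by norm_num) hX
  have hX1 : 1 < X := by linarith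
  have hX0 : 0 < X := by linarith
  have hL10 : 10 ≤ L := ten_le_log hX
  have hL0 : 0 < L := by linarith
  obtain ⟨h8e, h8q⟩ := rpow_lower_bounds' hX
  set z₇ := X ^ (1 / 2 - 2 * τ) with hz₇
  have hz₇q : X ^ (1 / 4 : ℝ) ≤ z₇ := Real.rpow_le_rpow_of_exponent_le hX1.le (by linarith)
  have hz₇pos : 0 < z₇ := Real.rpow_pos_of_pos hX0 _
  -- the first-degree primes of the ranges
  set W := (primesNormIco z₇ (X ^ (1 - τ))).filter (fun P => (Ideal.absNorm P).Prime) with hW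
  set W₃ := (primesNormIco z₇ (X ^ ((1 + τ) / 2))).filter (fun P => (Ideal.absNorm P).Prime) with hW₃
  have hWmem : ∀ P ∈ W, P.IsPrime ∧ P ≠ ⊥ ∧ (Ideal.absNorm P).Prime ∧
      z₇ ≤ (Ideal.absNorm P : ℝ) ∧ (Ideal.absNorm P : ℝ) < X ^ (1 - τ) := by
    intro P hP
    rw [hW, mem_filter, mem_primesNormIco_iff] at hP
    exact ⟨hP.1.1, hP.1.2.1, hP.2, hP.1.2.2.1, hP.1.2.2.2⟩
  have hW₃mem : ∀ P ∈ W₃, P.IsPrime ∧ P ≠ ⊥ ∧ (Ideal.absNorm P).Prime ∧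
      z₇ ≤ (Ideal.absNorm P : ℝ) ∧ (Ideal.absNorm P : ℝ) < X ^ ((1 + τ) / 2) := by
    intro P hP
    rw [hW₃, mem_filter, mem_primesNormIco_iff] at hP
    exact ⟨hP.1.1, hP.1.2.1, hP.2, hP.1.2.2.1, hP.1.2.2.2⟩
  set D := (W ×ˢ (W ×ˢ W₃)).filter (fun x => x.1 ≠ x.2.1) with hD
  set T₇ := (Upairs X τ 2).filter (fun t =>
      X ^ (3 / 2 - τ) < ((Ideal.absNorm (∏ P ∈ t.1, P) * Ideal.absNorm t.2 : ℕ) : ℝ)) with hT₇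
  have hcover := sum_inv_absNorm_uIdeal_two_le (T₇.filter UGood) D
    (fun x hx => (mem_filter.mp hx).2) (fun t ht => by
    rw [mem_filter] at ht
    obtain ⟨hT, hg⟩ := ht
    rw [hT₇] at hT
    obtain ⟨P₁, P₂, hne, h12, hP₁p, hP₁0, hP₁hi, hP₂p, hP₂0, hP₂hi, hP₃p, hP₃0, hz, hle1, hle2, hhalf,
      -, -, -, -⟩ := S₇_index hX1 hT
    have hle1' : (Ideal.absNorm t.2 : ℝ) ≤ Ideal.absNorm P₁ := by exact_mod_cast hle1
    have hle2' : (Ideal.absNorm t.2 : ℝ) ≤ Ideal.absNorm P₂ := by exact_mod_cast hle2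
    have hpr3 : (Ideal.absNorm t.2).Prime := hg.1 t.2 (mem_insert_self _ _)
    have hpr1 : (Ideal.absNorm P₁).Prime := hg.1 P₁ (by rw [h12]; simp)
    have hpr2 : (Ideal.absNorm P₂).Prime := hg.1 P₂ (by rw [h12]; simp)
    refine ⟨P₁, P₂, hne, h12, ?_⟩
    rw [hD, mem_filter, mem_product, mem_product]
    refine ⟨⟨?_, ?_, ?_⟩, hne⟩
    · rw [hW, mem_filter, mem_primesNormIco_iff]
      exact ⟨⟨hP₁p, hP₁0, hz.le.trans hle1', hP₁hi⟩, hpr1⟩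
    · rw [hW, mem_filter, mem_primesNormIco_iff]
      exact ⟨⟨hP₂p, hP₂0, hz.le.trans hle2', hP₂hi⟩, hpr2⟩
    · rw [hW₃, mem_filter, mem_primesNormIco_iff]
      exact ⟨⟨hP₃p, hP₃0, hz.le, hhalf⟩, hpr3⟩)
  -- drop the filter and factor
  have hfac : ∑ x ∈ D, ((Ideal.absNorm x.1 : ℕ) : ℝ)⁻¹ * ((Ideal.absNorm x.2.1 : ℕ) : ℝ)⁻¹ *
        ((Ideal.absNorm x.2.2 : ℕ) : ℝ)⁻¹ ≤
      (∑ P ∈ W, ((Ideal.absNorm P : ℕ) : ℝ)⁻¹) * (∑ P ∈ W, ((Ideal.absNorm P : ℕ) : ℝ)⁻¹) *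
        (∑ P ∈ W₃, ((Ideal.absNorm P : ℕ) : ℝ)⁻¹) := by
    rw [← sum_triple_mul_eq']
    exact sum_le_sum_of_subset_of_nonneg (filter_subset _ _) fun x _ _ => by positivity
  -- the window bounds
  have hlo2 : 2 ≤ z₇ / 2 := by linarith [h8q.trans hz₇q]
  have hden : L / 8 ≤ Real.log (z₇ / 2) := by
    have h18 : Real.log (X ^ (1 / 8 : ℝ)) = L / 8 := by rw [Real.log_rpow hX0]; ring
    rw [← h18]
    refine Real.log_le_log (by positivity) ?_
    rw [le_div_iff₀ (by norm_num)]
    calc X ^ (1 / 8 : ℝ) * 2 ≤ X ^ (1 / 8 : ℝ) * X ^ (1 / 8 : ℝ) :=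
          mul_le_mul_of_nonneg_left h8e (Real.rpow_nonneg hX0.le _)
      _ = X ^ (1 / 4 : ℝ) := by rw [← Real.rpow_add hX0]; norm_num
      _ ≤ z₇ := hz₇q
  have hX38 : 2 ≤ X ^ (1 / 2 - τ) := by
    calc (2 : ℝ) ≤ X ^ (1 / 8 : ℝ) := h8e
      _ ≤ X ^ (1 / 2 - τ) := Real.rpow_le_rpow_of_exponent_le hX1.le (by linarith)
  have hW_le : ∑ P ∈ W, ((Ideal.absNorm P : ℕ) : ℝ)⁻¹ ≤ 24 * (1 + K₁) := by
    have hlohi : z₇ / 2 ≤ X ^ (1 - τ) := by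
      have : z₇ ≤ X ^ (1 - τ) := Real.rpow_le_rpow_of_exponent_le hX1.le (by linarith)
      linarith
    have hw := sum_inv_absNorm_window_le hK hlo2 hlohi W (fun P hP => ⟨(hWmem P hP).1,
      (hWmem P hP).2.1, (hWmem P hP).2.2.1, by linarith [(hWmem P hP).2.2.2.1], (hWmem P hP).2.2.2.2.le⟩)
    refine hw.trans ?_
    have hnum : Real.log (X ^ (1 - τ) / (z₇ / 2)) ≤ L := by
      rw [hL]
      refine Real.log_le_log (by positivity) ?_
      rw [div_le_iff₀ (by positivity)]
      have h1 : X * (z₇ / 2) = X ^ (3 / 2 - 2 * τ) / 2 := by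
        rw [hz₇, show (3 / 2 - 2 * τ : ℝ) = 1 + (1 / 2 - 2 * τ) by ring, Real.rpow_add hX0,
          Real.rpow_one]; ring
      rw [h1, le_div_iff₀ (by norm_num)]
      calc X ^ (1 - τ) * 2 ≤ X ^ (1 - τ) * X ^ (1 / 2 - τ) :=
            mul_le_mul_of_nonneg_left hX38 (Real.rpow_nonneg hX0.le _)
        _ = X ^ (3 / 2 - 2 * τ) := by rw [← Real.rpow_add hX0]; ring_nf
    have hnum0 : 0 ≤ Real.log (X ^ (1 - τ) / (z₇ / 2)) + K₁ := by
      have : 0 ≤ Real.log (X ^ (1 - τ) / (z₇ / 2)) := by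
        refine Real.log_nonneg ?_
        rw [le_div_iff₀ (by positivity), one_mul]
        exact hlohi
      linarith
    calc 3 * ((Real.log (X ^ (1 - τ) / (z₇ / 2)) + K₁) / Real.log (z₇ / 2))
        ≤ 3 * ((L + K₁) / (L / 8)) := by
          gcongr 3 * ?_
          exact div_le_div₀ (by linarith) (by linarith) (by positivity) hden
      _ = 24 * (1 + K₁ / L) := by field_simp; ring
      _ ≤ 24 * (1 + K₁) := by
          have : K₁ / L ≤ K₁ := div_le_self hK₁ (by linarith)
          linarith
  have hW₃_le : ∑ P ∈ W₃, ((Ideal.absNorm P : ℕ) : ℝ)⁻¹ ≤ 24 * (4 + K₁) * τ := by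
    have hlohi : z₇ / 2 ≤ X ^ ((1 + τ) / 2) := by
      have : z₇ ≤ X ^ ((1 + τ) / 2) := Real.rpow_le_rpow_of_exponent_le hX1.le (by linarith)
      linarith
    have hw := sum_inv_absNorm_window_le hK hlo2 hlohi W₃ (fun P hP => ⟨(hW₃mem P hP).1,
      (hW₃mem P hP).2.1, (hW₃mem P hP).2.2.1, by linarith [(hW₃mem P hP).2.2.2.1],
      (hW₃mem P hP).2.2.2.2.le⟩)
    refine hw.trans ?_
    have hnum : Real.log (X ^ ((1 + τ) / 2) / (z₇ / 2)) ≤ 0.7 + 5 / 2 * τ * L := by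
      have heq : X ^ ((1 + τ) / 2) / (z₇ / 2) = 2 * X ^ (5 / 2 * τ) := by
        rw [hz₇, div_div_eq_mul_div, mul_comm, mul_div_assoc, ← Real.rpow_sub hX0]
        ring_nf
      rw [heq, Real.log_mul (by norm_num) (by positivity), Real.log_rpow hX0, ← hL]
      have := Real.log_two_lt_d9
      nlinarith
    have hnum0 : 0 ≤ Real.log (X ^ ((1 + τ) / 2) / (z₇ / 2)) + K₁ := by
      have : 0 ≤ Real.log (X ^ ((1 + τ) / 2) / (z₇ / 2)) := by
        refine Real.log_nonneg ?_
        rw [le_div_iff₀ (by positivity), one_mul]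
        exact hlohi
      linarith
    have hKL : (0.7 + K₁) / L ≤ (0.7 + K₁) * τ := by
      rw [div_eq_mul_inv]; exact mul_le_mul_of_nonneg_left hτL (by positivity)
    calc 3 * ((Real.log (X ^ ((1 + τ) / 2) / (z₇ / 2)) + K₁) / Real.log (z₇ / 2))
        ≤ 3 * ((0.7 + 5 / 2 * τ * L + K₁) / (L / 8)) := by
          gcongr 3 * ?_
          exact div_le_div₀ (by positivity) (by linarith) (by positivity) hden
      _ = 24 * ((0.7 + K₁) / L) + 60 * τ := by field_simp; ring
      _ ≤ 24 * ((0.7 + K₁) * τ) + 60 * τ := by linarith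
      _ ≤ 24 * (4 + K₁) * τ := by nlinarith
  have hW0 : 0 ≤ ∑ P ∈ W, ((Ideal.absNorm P : ℕ) : ℝ)⁻¹ := sum_nonneg fun _ _ => by positivity
  have hW₃0 : 0 ≤ ∑ P ∈ W₃, ((Ideal.absNorm P : ℕ) : ℝ)⁻¹ := sum_nonneg fun _ _ => by positivity
  calc _ ≤ _ := hcover
    _ ≤ _ := hfac
    _ ≤ (24 * (1 + K₁)) * (24 * (1 + K₁)) * (24 * (4 + K₁) * τ) := by
        gcongr
    _ = (24 * (1 + K₁)) ^ 2 * (24 * (4 + K₁)) * τ := by ring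

open scoped Classical in
/-- **The reciprocal sum over the defective indices of `S₇(ℬ)` is negligible**:
`≤ 972 (log X)² X^{−1/15}` (all three primes have norm `> X^{1/2−2τ} ≥ X^{1/4} > X^{1/5}`;
`sum_triple_defect_le`). [cite: HeathBrownActa2001, §7 p. 42] -/
theorem S₇_bad_sum_le {X τ : ℝ} (hX : (2 : ℝ) ^ 15 ≤ X) (hτ0 : 0 ≤ τ) (hτ8 : τ ≤ 1 / 8) :
    ∑ t ∈ ((Upairs X τ 2).filter (fun t =>
      X ^ (3 / 2 - τ) < ((Ideal.absNorm (∏ P ∈ t.1, P) * Ideal.absNorm t.2 : ℕ) : ℝ))).filter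
          (fun t => ¬ UGood t),
        ((Ideal.absNorm (uIdeal t) : ℕ) : ℝ)⁻¹ ≤ 972 * Real.log X ^ 2 * X ^ (-(1 / 15 : ℝ)) := by
  classical
  set L := Real.log X with hL
  have hX16 : 16 ≤ X := le_trans (by norm_num) hX
  have hX1 : 1 < X := by linarith
  have hX0 : 0 < X := by linarith
  have hL10 : 10 ≤ L := ten_le_log hX
  have hL1 : 1 ≤ L := by linarith
  obtain ⟨h8, -, -⟩ := rpow_lower_bounds hX
  set z₇ := X ^ (1 / 2 - 2 * τ) with hz₇
  have h15 : X ^ (1 / 5 : ℝ) < z₇ := Real.rpow_lt_rpow_of_exponent_lt hX1 (by linarith)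
  set V := primesNormIco z₇ (X ^ (1 - τ)) with hV
  have hVmem : ∀ P ∈ V, P.IsPrime ∧ P ≠ ⊥ ∧ X ^ (1 / 5 : ℝ) < (Ideal.absNorm P : ℝ) ∧
      (Ideal.absNorm P : ℝ) ≤ X := by
    intro P hP
    rw [hV, mem_primesNormIco_iff] at hP
    refine ⟨hP.1, hP.2.1, h15.trans_le hP.2.2.1, hP.2.2.2.le.trans ?_⟩
    calc X ^ (1 - τ) ≤ X ^ (1 : ℝ) := Real.rpow_le_rpow_of_exponent_le hX1.le (by linarith)
      _ = X := Real.rpow_one X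
  set D := (V ×ˢ (V ×ˢ V)).filter (fun p => p.1 ≠ p.2.1 ∧
      (¬ (Ideal.absNorm p.1).Prime ∨ ¬ (Ideal.absNorm p.2.1).Prime ∨ ¬ (Ideal.absNorm p.2.2).Prime ∨
        Ideal.absNorm p.1 = Ideal.absNorm p.2.1 ∨ Ideal.absNorm p.1 = Ideal.absNorm p.2.2 ∨
        Ideal.absNorm p.2.1 = Ideal.absNorm p.2.2)) with hD
  set T₇ := (Upairs X τ 2).filter (fun t =>
      X ^ (3 / 2 - τ) < ((Ideal.absNorm (∏ P ∈ t.1, P) * Ideal.absNorm t.2 : ℕ) : ℝ)) with hT₇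
  have hcover := sum_inv_absNorm_uIdeal_two_le (T₇.filter fun t => ¬ UGood t) D
    (fun x hx => (mem_filter.mp hx).2.1) (fun t ht => by
    rw [mem_filter] at ht
    obtain ⟨hT, hg⟩ := ht
    rw [hT₇] at hT
    obtain ⟨P₁, P₂, hne, h12, hP₁p, hP₁0, hP₁hi, hP₂p, hP₂0, hP₂hi, hP₃p, hP₃0, hz, hle1, hle2, -,
      hP₃hi, -, -, -⟩ := S₇_index hX1 hT
    have hle1' : (Ideal.absNorm t.2 : ℝ) ≤ Ideal.absNorm P₁ := by exact_mod_cast hle1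
    have hle2' : (Ideal.absNorm t.2 : ℝ) ≤ Ideal.absNorm P₂ := by exact_mod_cast hle2
    refine ⟨P₁, P₂, hne, h12, ?_⟩
    rw [hD, mem_filter, mem_product, mem_product]
    refine ⟨⟨?_, ?_, ?_⟩, hne, ?_⟩
    · rw [hV, mem_primesNormIco_iff]; exact ⟨hP₁p, hP₁0, hz.le.trans hle1', hP₁hi⟩
    · rw [hV, mem_primesNormIco_iff]; exact ⟨hP₂p, hP₂0, hz.le.trans hle2', hP₂hi⟩
    · rw [hV, mem_primesNormIco_iff]; exact ⟨hP₃p, hP₃0, hz.le, hP₃hi⟩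
    · -- translate `¬ UGood t`
      unfold UGood at hg
      rw [h12, not_and_or] at hg
      rcases hg with hg | hg
      · push Not at hg
        obtain ⟨P, hP, hnp⟩ := hg
        simp only [mem_insert, mem_singleton] at hP
        rcases hP with rfl | rfl | rfl
        · exact Or.inr (Or.inr (Or.inl hnp))
        · exact Or.inl hnp
        · exact Or.inr (Or.inl hnp)
      · rw [Set.InjOn] at hg
        push Not at hg
        obtain ⟨a, ha, b, hb, hab, hne'⟩ := hg
        simp only [coe_insert, coe_singleton, Set.mem_insert_iff, Set.mem_singleton_iff] at ha hb
        rcases ha with rfl | rfl | rfl <;> rcases hb with rfl | rfl | rfl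
        · exact absurd rfl hne'
        · exact Or.inr (Or.inr (Or.inr (Or.inr (Or.inl hab.symm))))
        · exact Or.inr (Or.inr (Or.inr (Or.inr (Or.inr hab.symm))))
        · exact Or.inr (Or.inr (Or.inr (Or.inr (Or.inl hab))))
        · exact absurd rfl hne'
        · exact Or.inr (Or.inr (Or.inr (Or.inl hab)))
        · exact Or.inr (Or.inr (Or.inr (Or.inr (Or.inr hab))))
        · exact Or.inr (Or.inr (Or.inr (Or.inl hab.symm)))
        · exact absurd rfl hne')
  have hsub : D ⊆ (V ×ˢ (V ×ˢ V)).filter (fun p =>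
      ¬ (Ideal.absNorm p.1).Prime ∨ ¬ (Ideal.absNorm p.2.1).Prime ∨ ¬ (Ideal.absNorm p.2.2).Prime ∨
        Ideal.absNorm p.1 = Ideal.absNorm p.2.1 ∨ Ideal.absNorm p.1 = Ideal.absNorm p.2.2 ∨
        Ideal.absNorm p.2.1 = Ideal.absNorm p.2.2) := by
    intro x hx
    rw [hD, mem_filter] at hx
    exact mem_filter.mpr ⟨hx.1, hx.2.2⟩
  have hdef := sum_triple_defect_le (Y := X ^ (1 / 5 : ℝ)) (x := X) h8 hX1.le V hVmem
  have hY3 : (X ^ (1 / 5 : ℝ)) ^ (1 / 3 : ℝ) = X ^ (1 / 15 : ℝ) := by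
    rw [← Real.rpow_mul hX0.le]; norm_num
  have h1 : 6 / (X ^ (1 / 5 : ℝ)) ^ (1 / 3 : ℝ) = 6 * X ^ (-(1 / 15 : ℝ)) := by
    rw [hY3, Real.rpow_neg hX0.le, div_eq_mul_inv]
  have h2 : 18 / X ^ (1 / 5 : ℝ) ≤ 18 * X ^ (-(1 / 15 : ℝ)) := by
    rw [div_eq_mul_inv, ← Real.rpow_neg hX0.le]
    exact mul_le_mul_of_nonneg_left (Real.rpow_le_rpow_of_exponent_le hX1.le (by norm_num)) (by norm_num)
  have hXp : 0 ≤ X ^ (-(1 / 15 : ℝ)) := Real.rpow_nonneg hX0.le _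
  have hH0 : 0 ≤ 3 * (1 + L) := by positivity
  calc _ ≤ _ := hcover
    _ ≤ _ := sum_le_sum_of_subset_of_nonneg hsub fun x _ _ => by positivity
    _ ≤ 3 * (6 / (X ^ (1 / 5 : ℝ)) ^ (1 / 3 : ℝ)) * (3 * (1 + Real.log X)) ^ 2 +
          3 * (18 / X ^ (1 / 5 : ℝ)) * (3 * (1 + Real.log X)) := hdef
    _ ≤ 3 * (6 * X ^ (-(1 / 15 : ℝ))) * (3 * (1 + L)) ^ 2 + 3 * (18 * X ^ (-(1 / 15 : ℝ))) * (3 * (1 + L)) := by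
        rw [h1, ← hL]; gcongr
    _ = (162 * (1 + L) ^ 2 + 162 * (1 + L)) * X ^ (-(1 / 15 : ℝ)) := by ring
    _ ≤ (972 * L ^ 2) * X ^ (-(1 / 15 : ℝ)) := by
        refine mul_le_mul_of_nonneg_right ?_ hXp
        nlinarith
    _ = 972 * L ^ 2 * X ^ (-(1 / 15 : ℝ)) := by ring

open scoped Classical in
/-- **`S₇(𝒜) + κS₇(ℬ) ≪ τη²X²/log X`** (p. 41), from the corrected Lemma 7.1 in weighted form (`h7A`,
`h7B`, weight `w ≤ 512/N` on products of three distinct first-degree primes), via `uPiece_pair_le`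
with level `X^{1/2−2τ}`, range `(X^{3/2−τ}, X^{(3+3τ)/2})`, `min(z, X^{2−τ}/b) ≥ X^{3/16}`, and the
sums `S₇_good_sum_le`, `S₇_bad_sum_le`. [cite: HeathBrownActa2001, §7 p. 41] -/
theorem S₇_piece_le {X η τ σ₀ C₇ C_B K₁ : ℝ} {w : Ideal (𝓞 K) → ℝ}
    (hX : (2 : ℝ) ^ 15 ≤ X) (hτ0 : 0 < τ) (hτ8 : τ ≤ 1 / 8) (hτL : (Real.log X)⁻¹ ≤ τ)
    (hη0 : 0 < η) (hη1 : η ≤ 1) (hσ0 : 0 ≤ σ₀) (hC₇ : 0 ≤ C₇) (hCB : 0 ≤ C_B) (hK₁ : 0 ≤ K₁)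
    (habs : X ^ (-τ / 5) * Real.log X ^ 3 ≤ τ * η ^ 2 / Real.log X)
    (hK : ∀ (lo hi : ℝ) (T : Finset ℕ), 2 ≤ lo → lo ≤ hi →
      (∀ p ∈ T, p.Prime ∧ lo < (p : ℝ) ∧ (p : ℝ) ≤ hi) →
      ∑ p ∈ T, (p : ℝ)⁻¹ ≤ (Real.log (hi / lo) + K₁) / Real.log lo)
    (hw0 : ∀ Q, 0 ≤ w Q)
    (hwU : ∀ (n : ℕ) (t : Finset (Ideal (𝓞 K)) × Ideal (𝓞 K)), t ∈ Upairs X τ n → UGood t →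
      w (uIdeal t) ≤ 8 ^ (n + 1) * ((Ideal.absNorm (uIdeal t) : ℕ) : ℝ)⁻¹)
    (h7A : ∀ (N z : ℝ) (𝒮 : Finset (Ideal (𝓞 K))), X ^ τ ≤ z → 0 < N → N ≤ X ^ (2 - 2 * τ) →
        (∀ Q ∈ 𝒮, Squarefree (Ideal.absNorm Q) ∧ N < (Ideal.absNorm Q : ℝ) ∧
          (Ideal.absNorm Q : ℝ) ≤ 2 * N) →
        ∑ Q ∈ 𝒮, (siftedA X η Q z : ℝ) ≤
          C₇ * (η ^ 2 * X ^ 2 / Real.log (min z (X ^ (2 - τ) / N)) * ∑ Q ∈ 𝒮, w Q + X ^ (2 - τ / 5)))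
    (h7B : ∀ (N z : ℝ) (𝒮 : Finset (Ideal (𝓞 K))), X ^ τ ≤ z → 0 < N → N ≤ X ^ (2 - 2 * τ) →
        (∀ Q ∈ 𝒮, Squarefree (Ideal.absNorm Q) ∧ N < (Ideal.absNorm Q : ℝ) ∧
          (Ideal.absNorm Q : ℝ) ≤ 2 * N) →
        ∑ Q ∈ 𝒮, (siftedB X η Q z : ℝ) ≤
          C₇ * (η * X ^ 3 / Real.log (min z (X ^ (2 - τ) / N)) * ∑ Q ∈ 𝒮, w Q + X ^ (3 - τ / 5)))
    (hcountB : ∀ R : Ideal (𝓞 K), R ≠ ⊥ → (countB X η R : ℝ) ≤ C_B * X ^ 3 / Ideal.absNorm R) :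
    (S₇ (boxPairs X η) pairIdeal X τ : ℝ) + kappa σ₀ X η * S₇ (normWindow X η) (fun J => J) X τ ≤
      (C₇ * 512 * ((24 * (1 + K₁)) ^ 2 * (24 * (4 + K₁))) / (3 / 16) + 3 * C₇ +
          σ₀ * C₇ * 512 * ((24 * (1 + K₁)) ^ 2 * (24 * (4 + K₁))) / (3 * (3 / 16)) + σ₀ * C₇ +
          σ₀ * C_B * 972 / 3) *
        (τ * η ^ 2 * X ^ 2 / Real.log X) := by
  classical
  have hX16 : 16 ≤ X := le_trans (by norm_num) hX
  have hX1 : 1 < X := by linarith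
  have hX0 : 0 < X := by linarith
  set T₇ := (Upairs X τ 2).filter (fun t =>
      X ^ (3 / 2 - τ) < ((Ideal.absNorm (∏ P ∈ t.1, P) * Ideal.absNorm t.2 : ℕ) : ℝ)) with hT₇
  have hSA : (S₇ (boxPairs X η) pairIdeal X τ : ℝ) =
      ∑ t ∈ T₇, (famSiftedAbove (boxPairs X η) pairIdeal (uIdeal t) t.2 : ℝ) := by
    rw [S₇, UpieceWhere_eq, Nat.cast_sum]
  have hSB : (S₇ (normWindow X η) (fun J => J) X τ : ℝ) =
      ∑ t ∈ T₇, (famSiftedAbove (normWindow X η) (fun J => J) (uIdeal t) t.2 : ℝ) := by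
    rw [S₇, UpieceWhere_eq, Nat.cast_sum]
  rw [hSA, hSB]
  have hT : T₇ ⊆ Upairs X τ 2 := filter_subset _ _
  -- parameters of `uPiece_pair_le`
  have hzτ : X ^ τ ≤ X ^ (1 / 2 - 2 * τ) := Real.rpow_le_rpow_of_exponent_le hX1.le (by linarith)
  have ha2 : 2 ≤ X ^ (3 / 2 - τ) := by
    calc (2 : ℝ) ≤ X ^ (1 : ℝ) := by rw [Real.rpow_one]; linarith
      _ ≤ X ^ (3 / 2 - τ) := Real.rpow_le_rpow_of_exponent_le hX1.le (by linarith)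
  have hab : X ^ (3 / 2 - τ) ≤ X ^ ((3 + 3 * τ) / 2) :=
    Real.rpow_le_rpow_of_exponent_le hX1.le (by linarith)
  have hb : X ^ ((3 + 3 * τ) / 2) ≤ X ^ (2 - 2 * τ) :=
    Real.rpow_le_rpow_of_exponent_le hX1.le (by linarith)
  have hb2 : X ^ ((3 + 3 * τ) / 2) ≤ X ^ 2 := by
    calc X ^ ((3 + 3 * τ) / 2) ≤ X ^ (2 : ℝ) := Real.rpow_le_rpow_of_exponent_le hX1.le (by linarith)
      _ = X ^ 2 := Real.rpow_two X
  have hmin : X ^ (3 / 16 : ℝ) ≤ min (X ^ (1 / 2 - 2 * τ)) (X ^ (2 - τ) / X ^ ((3 + 3 * τ) / 2)) := by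
    refine le_min (Real.rpow_le_rpow_of_exponent_le hX1.le (by linarith)) ?_
    rw [← Real.rpow_sub hX0]
    exact Real.rpow_le_rpow_of_exponent_le hX1.le (by linarith)
  have hz : ∀ t ∈ T₇, X ^ (1 / 2 - 2 * τ) ≤ Ideal.absNorm t.2 := by
    intro t ht
    rw [hT₇] at ht
    obtain ⟨_, _, -, -, -, -, -, -, -, -, -, -, hz, -⟩ := S₇_index hX1 ht
    exact hz.le
  have hrange : ∀ t ∈ T₇, X ^ (3 / 2 - τ) ≤ (Ideal.absNorm (uIdeal t) : ℝ) ∧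
      (Ideal.absNorm (uIdeal t) : ℝ) < X ^ ((3 + 3 * τ) / 2) := by
    intro t ht
    rw [hT₇] at ht
    obtain ⟨P₁, P₂, -, -, -, -, -, -, -, -, -, -, -, -, -, -, -, hlo, hhi, hN⟩ := S₇_index hX1 ht
    rw [hN]
    exact ⟨hlo.le, hhi⟩
  have hgood := S₇_good_sum_le hX hτ0 hτ8 hτL hK₁ hK
  have hbad := S₇_bad_sum_le (τ := τ) hX hτ0.le hτ8
  have h := uPiece_pair_le (n := 2) (cm := 3 / 16) (mU := 512)
    (Wc := (24 * (1 + K₁)) ^ 2 * (24 * (4 + K₁))) (Wb := 972)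
    hX hη0 hη1 hσ0 hC₇ hCB (by norm_num) (by norm_num) (by norm_num) (by linarith) habs hw0 h7A h7B
    hcountB T₇ hT (fun t ht hg => by have := hwU 2 t (hT ht) hg; norm_num at this; exact this)
    hzτ hz ha2 hab hb hb2 hmin hrange hgood hbad
  exact h

/-! ### The pieces `S₃` and `S₅` (p. 41) -/

/-- **`S₃(𝒜) + κS₃(ℬ) ≪ τη²X²/log X`** (p. 41: "`S₃(𝒜) ≪ ∑_{X^{1−τ}≤p<X^{1+τ}} η²X²/(p log X) +
X^{2−τ/5} ≪ τη²X²/log X`", "One may handle `S₃(ℬ)` in much the same way"), from the corrected Lemma 7.1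
in weighted form via `primeRange_piece_le` on the range `[X^{1−τ}, X^{1+τ})` (window factor
`3(log 2X^{2τ} + K₁)/log(X^{1−τ}/2) ≤ 6(3 + K₁)τ`). [cite: HeathBrownActa2001, §7 p. 41] -/
theorem S₃_piece_le {X η τ σ₀ C₇ C_B K₁ : ℝ} {w : Ideal (𝓞 K) → ℝ}
    (hX : (2 : ℝ) ^ 15 ≤ X) (hτ0 : 0 < τ) (hτ8 : τ ≤ 1 / 8) (hτL : (Real.log X)⁻¹ ≤ τ)
    (hη0 : 0 < η) (hη1 : η ≤ 1) (hσ0 : 0 ≤ σ₀) (hC₇ : 0 ≤ C₇) (hCB : 0 ≤ C_B) (hK₁ : 0 ≤ K₁)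
    (habs : X ^ (-τ / 5) * Real.log X ^ 3 ≤ τ * η ^ 2 / Real.log X)
    (hK : ∀ (lo hi : ℝ) (T : Finset ℕ), 2 ≤ lo → lo ≤ hi →
      (∀ p ∈ T, p.Prime ∧ lo < (p : ℝ) ∧ (p : ℝ) ≤ hi) →
      ∑ p ∈ T, (p : ℝ)⁻¹ ≤ (Real.log (hi / lo) + K₁) / Real.log lo)
    (hw0 : ∀ Q, 0 ≤ w Q)
    (hwP : ∀ P : Ideal (𝓞 K), (Ideal.absNorm P).Prime → w P ≤ 8 * ((Ideal.absNorm P : ℕ) : ℝ)⁻¹)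
    (h7A : ∀ (N z : ℝ) (𝒮 : Finset (Ideal (𝓞 K))), X ^ τ ≤ z → 0 < N → N ≤ X ^ (2 - 2 * τ) →
        (∀ Q ∈ 𝒮, Squarefree (Ideal.absNorm Q) ∧ N < (Ideal.absNorm Q : ℝ) ∧
          (Ideal.absNorm Q : ℝ) ≤ 2 * N) →
        ∑ Q ∈ 𝒮, (siftedA X η Q z : ℝ) ≤
          C₇ * (η ^ 2 * X ^ 2 / Real.log (min z (X ^ (2 - τ) / N)) * ∑ Q ∈ 𝒮, w Q + X ^ (2 - τ / 5)))
    (h7B : ∀ (N z : ℝ) (𝒮 : Finset (Ideal (𝓞 K))), X ^ τ ≤ z → 0 < N → N ≤ X ^ (2 - 2 * τ) →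
        (∀ Q ∈ 𝒮, Squarefree (Ideal.absNorm Q) ∧ N < (Ideal.absNorm Q : ℝ) ∧
          (Ideal.absNorm Q : ℝ) ≤ 2 * N) →
        ∑ Q ∈ 𝒮, (siftedB X η Q z : ℝ) ≤
          C₇ * (η * X ^ 3 / Real.log (min z (X ^ (2 - τ) / N)) * ∑ Q ∈ 𝒮, w Q + X ^ (3 - τ / 5)))
    (hcountB : ∀ R : Ideal (𝓞 K), R ≠ ⊥ → (countB X η R : ℝ) ≤ C_B * X ^ 3 / Ideal.absNorm R) :
    (S₃ (boxPairs X η) pairIdeal X τ : ℝ) + kappa σ₀ X η * S₃ (normWindow X η) (fun J => J) X τ ≤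
      (32 * C₇ * (6 * (3 + K₁)) + 3 * C₇ + 32 / 3 * σ₀ * C₇ * (6 * (3 + K₁)) + σ₀ * C₇ + 3 * σ₀ * C_B) *
        (τ * η ^ 2 * X ^ 2 / Real.log X) := by
  set L := Real.log X with hL
  have hX16 : 16 ≤ X := le_trans (by norm_num) hX
  have hX1 : 1 < X := by linarith
  have hX0 : 0 < X := by linarith
  have hL10 : 10 ≤ L := ten_le_log hX
  have hL0 : 0 < L := by linarith
  have hl2 := Real.log_two_lt_d9
  have hl2' := Real.log_two_gt_d9
  -- the range `[X^{1−τ}, X^{1+τ})`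
  have hXa : X ^ (1 / 2 : ℝ) ≤ X ^ (1 - τ) := Real.rpow_le_rpow_of_exponent_le hX1.le (by linarith)
  have hab : X ^ (1 - τ) ≤ X ^ (1 + τ) := Real.rpow_le_rpow_of_exponent_le hX1.le (by linarith)
  have hbτ : X ^ (1 + τ) ≤ X ^ (2 - 2 * τ) := Real.rpow_le_rpow_of_exponent_le hX1.le (by linarith)
  have hb2 : X ^ (1 + τ) ≤ X ^ 2 := by
    calc X ^ (1 + τ) ≤ X ^ (2 : ℝ) := Real.rpow_le_rpow_of_exponent_le hX1.le (by linarith)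
      _ = X ^ 2 := Real.rpow_two X
  have hm : X ^ (1 / 4 : ℝ) ≤ min (X ^ (1 / 2 : ℝ)) (X ^ (2 - τ) / X ^ (1 + τ)) := by
    refine le_min (Real.rpow_le_rpow_of_exponent_le hX1.le (by norm_num)) ?_
    rw [← Real.rpow_sub hX0]
    exact Real.rpow_le_rpow_of_exponent_le hX1.le (by linarith)
  -- the window factor
  have hwin : 3 * ((Real.log (X ^ (1 + τ) / (X ^ (1 - τ) / 2)) + K₁) / Real.log (X ^ (1 - τ) / 2)) ≤
      6 * (3 + K₁) * τ := by
    have hnum : Real.log (X ^ (1 + τ) / (X ^ (1 - τ) / 2)) = Real.log 2 + 2 * τ * L := by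
      have heq : X ^ (1 + τ) / (X ^ (1 - τ) / 2) = 2 * X ^ (2 * τ) := by
        rw [div_div_eq_mul_div, mul_comm, mul_div_assoc, ← Real.rpow_sub hX0]; ring_nf
      rw [heq, Real.log_mul (by norm_num) (by positivity), Real.log_rpow hX0, ← hL]
    have hden : Real.log (X ^ (1 - τ) / 2) = (1 - τ) * L - Real.log 2 := by
      rw [Real.log_div (by positivity) (by norm_num), Real.log_rpow hX0, ← hL]
    have hdenL : L / 2 ≤ Real.log (X ^ (1 - τ) / 2) := by rw [hden]; nlinarith
    rw [hnum]
    have hKL : (0.7 + K₁) / L ≤ (0.7 + K₁) * τ := by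
      rw [div_eq_mul_inv]; exact mul_le_mul_of_nonneg_left hτL (by positivity)
    calc 3 * ((Real.log 2 + 2 * τ * L + K₁) / Real.log (X ^ (1 - τ) / 2))
        ≤ 3 * ((0.7 + 2 * τ * L + K₁) / (L / 2)) := by
          gcongr 3 * ?_
          exact div_le_div₀ (by positivity) (by linarith) (by positivity) hdenL
      _ = 6 * ((0.7 + K₁) / L) + 12 * τ := by field_simp; ring
      _ ≤ 6 * ((0.7 + K₁) * τ) + 12 * τ := by linarith
      _ ≤ 6 * (3 + K₁) * τ := by nlinarith
  -- the degree `≥ 2` primes of `ℬ`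
  have hbad : (Real.sqrt (X ^ (1 + τ)) + 1) / X ^ (1 - τ) ≤ 3 * X ^ (-(1 / 4 : ℝ)) := by
    have hsq : Real.sqrt (X ^ (1 + τ)) = X ^ ((1 + τ) / 2) := by
      rw [Real.sqrt_eq_rpow, ← Real.rpow_mul hX0.le]; ring_nf
    have h1 : 1 ≤ X ^ ((1 + τ) / 2) := Real.one_le_rpow hX1.le (by linarith)
    have hpos : 0 < X ^ (1 - τ) := Real.rpow_pos_of_pos hX0 _
    rw [hsq, div_le_iff₀ hpos]
    have h2 : X ^ ((1 + τ) / 2) = X ^ (-(1 / 4 : ℝ)) * X ^ (1 - τ) * X ^ (3 / 2 * τ - 1 / 4) := by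
      rw [← Real.rpow_add hX0, ← Real.rpow_add hX0]; ring_nf
    have h3 : X ^ (3 / 2 * τ - 1 / 4) ≤ 1 := Real.rpow_le_one_of_one_le_of_nonpos hX1.le (by linarith)
    have h4 : 0 ≤ X ^ (-(1 / 4 : ℝ)) * X ^ (1 - τ) := by positivity
    calc X ^ ((1 + τ) / 2) + 1 ≤ 2 * X ^ ((1 + τ) / 2) := by linarith
      _ = 2 * (X ^ (-(1 / 4 : ℝ)) * X ^ (1 - τ) * X ^ (3 / 2 * τ - 1 / 4)) := by rw [← h2]
      _ ≤ 2 * (X ^ (-(1 / 4 : ℝ)) * X ^ (1 - τ) * 1) := by gcongr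
      _ ≤ 3 * X ^ (-(1 / 4 : ℝ)) * X ^ (1 - τ) := by nlinarith
  have h := primeRange_piece_le (Wc := 6 * (3 + K₁)) hX hτ8 hη0 hη1 hσ0 hC₇ hCB habs hK hw0 hwP h7A h7B
    hcountB hXa hab hbτ hb2 hm hwin hbad
  rw [S₃, S₃]
  exact h

/-- **`S₅(𝒜) + κS₅(ℬ) ≪ τη²X²/log X`** (p. 41: "The treatment of `S₅` is entirely analogous to that used
for `S₃`"), from the corrected Lemma 7.1 in weighted form via `primeRange_piece_le` on the range
`[X^{3/2−τ}, 2X^{3/2})` (window factor `3(log 4X^{τ} + K₁)/log(X^{3/2−τ}/2) ≤ 3(3 + K₁)τ`).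
[cite: HeathBrownActa2001, §7 p. 41] -/
theorem S₅_piece_le {X η τ σ₀ C₇ C_B K₁ : ℝ} {w : Ideal (𝓞 K) → ℝ}
    (hX : (2 : ℝ) ^ 15 ≤ X) (hτ0 : 0 < τ) (hτ8 : τ ≤ 1 / 8) (hτL : (Real.log X)⁻¹ ≤ τ)
    (hη0 : 0 < η) (hη1 : η ≤ 1) (hσ0 : 0 ≤ σ₀) (hC₇ : 0 ≤ C₇) (hCB : 0 ≤ C_B) (hK₁ : 0 ≤ K₁)
    (habs : X ^ (-τ / 5) * Real.log X ^ 3 ≤ τ * η ^ 2 / Real.log X)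
    (hK : ∀ (lo hi : ℝ) (T : Finset ℕ), 2 ≤ lo → lo ≤ hi →
      (∀ p ∈ T, p.Prime ∧ lo < (p : ℝ) ∧ (p : ℝ) ≤ hi) →
      ∑ p ∈ T, (p : ℝ)⁻¹ ≤ (Real.log (hi / lo) + K₁) / Real.log lo)
    (hw0 : ∀ Q, 0 ≤ w Q)
    (hwP : ∀ P : Ideal (𝓞 K), (Ideal.absNorm P).Prime → w P ≤ 8 * ((Ideal.absNorm P : ℕ) : ℝ)⁻¹)
    (h7A : ∀ (N z : ℝ) (𝒮 : Finset (Ideal (𝓞 K))), X ^ τ ≤ z → 0 < N → N ≤ X ^ (2 - 2 * τ) →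
        (∀ Q ∈ 𝒮, Squarefree (Ideal.absNorm Q) ∧ N < (Ideal.absNorm Q : ℝ) ∧
          (Ideal.absNorm Q : ℝ) ≤ 2 * N) →
        ∑ Q ∈ 𝒮, (siftedA X η Q z : ℝ) ≤
          C₇ * (η ^ 2 * X ^ 2 / Real.log (min z (X ^ (2 - τ) / N)) * ∑ Q ∈ 𝒮, w Q + X ^ (2 - τ / 5)))
    (h7B : ∀ (N z : ℝ) (𝒮 : Finset (Ideal (𝓞 K))), X ^ τ ≤ z → 0 < N → N ≤ X ^ (2 - 2 * τ) →
        (∀ Q ∈ 𝒮, Squarefree (Ideal.absNorm Q) ∧ N < (Ideal.absNorm Q : ℝ) ∧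
          (Ideal.absNorm Q : ℝ) ≤ 2 * N) →
        ∑ Q ∈ 𝒮, (siftedB X η Q z : ℝ) ≤
          C₇ * (η * X ^ 3 / Real.log (min z (X ^ (2 - τ) / N)) * ∑ Q ∈ 𝒮, w Q + X ^ (3 - τ / 5)))
    (hcountB : ∀ R : Ideal (𝓞 K), R ≠ ⊥ → (countB X η R : ℝ) ≤ C_B * X ^ 3 / Ideal.absNorm R) :
    (S₅ (boxPairs X η) pairIdeal X τ : ℝ) + kappa σ₀ X η * S₅ (normWindow X η) (fun J => J) X τ ≤
      (32 * C₇ * (3 * (3 + K₁)) + 3 * C₇ + 32 / 3 * σ₀ * C₇ * (3 * (3 + K₁)) + σ₀ * C₇ + 3 * σ₀ * C_B) *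
        (τ * η ^ 2 * X ^ 2 / Real.log X) := by
  set L := Real.log X with hL
  have hX16 : 16 ≤ X := le_trans (by norm_num) hX
  have hX1 : 1 < X := by linarith
  have hX0 : 0 < X := by linarith
  have hL10 : 10 ≤ L := ten_le_log hX
  have hL0 : 0 < L := by linarith
  have hl2 := Real.log_two_lt_d9
  have hl2' := Real.log_two_gt_d9
  obtain ⟨-, h4, h2⟩ := rpow_lower_bounds hX
  obtain ⟨h8e, -⟩ := rpow_lower_bounds' hX
  have hX32 : 0 < X ^ (3 / 2 : ℝ) := Real.rpow_pos_of_pos hX0 _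
  -- the range `[X^{3/2−τ}, 2X^{3/2})`
  have hXa : X ^ (1 / 2 : ℝ) ≤ X ^ (3 / 2 - τ) := Real.rpow_le_rpow_of_exponent_le hX1.le (by linarith)
  have hab : X ^ (3 / 2 - τ) ≤ 2 * X ^ (3 / 2 : ℝ) := by
    calc X ^ (3 / 2 - τ) ≤ X ^ (3 / 2 : ℝ) := Real.rpow_le_rpow_of_exponent_le hX1.le (by linarith)
      _ ≤ 2 * X ^ (3 / 2 : ℝ) := by linarith
  have hbτ : 2 * X ^ (3 / 2 : ℝ) ≤ X ^ (2 - 2 * τ) := by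
    have heq : X ^ (2 - 2 * τ) = X ^ (1 / 2 - 2 * τ) * X ^ (3 / 2 : ℝ) := by
      rw [← Real.rpow_add hX0]; ring_nf
    rw [heq]
    refine mul_le_mul_of_nonneg_right ?_ hX32.le
    calc (2 : ℝ) ≤ X ^ (1 / 4 : ℝ) := h4
      _ ≤ X ^ (1 / 2 - 2 * τ) := Real.rpow_le_rpow_of_exponent_le hX1.le (by linarith)
  have hb2 : 2 * X ^ (3 / 2 : ℝ) ≤ X ^ 2 := by
    have heq : X ^ 2 = X ^ (1 / 2 : ℝ) * X ^ (3 / 2 : ℝ) := by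
      rw [← Real.rpow_add hX0, ← Real.rpow_two]; norm_num
    rw [heq]
    exact mul_le_mul_of_nonneg_right (by linarith) hX32.le
  have hm : X ^ (1 / 4 : ℝ) ≤ min (X ^ (1 / 2 : ℝ)) (X ^ (2 - τ) / (2 * X ^ (3 / 2 : ℝ))) := by
    refine le_min (Real.rpow_le_rpow_of_exponent_le hX1.le (by norm_num)) ?_
    rw [le_div_iff₀ (by positivity)]
    have heq : X ^ (2 - τ) = X ^ (3 / 8 - τ) * X ^ (1 / 8 : ℝ) * X ^ (3 / 2 : ℝ) := by
      rw [← Real.rpow_add hX0, ← Real.rpow_add hX0]; ring_nf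
    rw [heq]
    have h38 : X ^ (1 / 4 : ℝ) ≤ X ^ (3 / 8 - τ) := Real.rpow_le_rpow_of_exponent_le hX1.le (by linarith)
    have h14 : 0 ≤ X ^ (1 / 4 : ℝ) := Real.rpow_nonneg hX0.le _
    calc X ^ (1 / 4 : ℝ) * (2 * X ^ (3 / 2 : ℝ)) = X ^ (1 / 4 : ℝ) * 2 * X ^ (3 / 2 : ℝ) := by ring
      _ ≤ X ^ (3 / 8 - τ) * X ^ (1 / 8 : ℝ) * X ^ (3 / 2 : ℝ) := by gcongr
  -- the window factor
  have hwin : 3 * ((Real.log (2 * X ^ (3 / 2 : ℝ) / (X ^ (3 / 2 - τ) / 2)) + K₁) /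
      Real.log (X ^ (3 / 2 - τ) / 2)) ≤ 3 * (3 + K₁) * τ := by
    have hnum : Real.log (2 * X ^ (3 / 2 : ℝ) / (X ^ (3 / 2 - τ) / 2)) = 2 * Real.log 2 + τ * L := by
      have heq : 2 * X ^ (3 / 2 : ℝ) / (X ^ (3 / 2 - τ) / 2) = 2 ^ 2 * X ^ τ := by
        rw [div_div_eq_mul_div, mul_assoc, mul_comm (X ^ (3 / 2 : ℝ)), ← mul_assoc, mul_div_assoc,
          ← Real.rpow_sub hX0]
        ring_nf
      rw [heq, Real.log_mul (by norm_num) (by positivity), Real.log_pow, Real.log_rpow hX0, ← hL]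
      push_cast; ring
    have hden : Real.log (X ^ (3 / 2 - τ) / 2) = (3 / 2 - τ) * L - Real.log 2 := by
      rw [Real.log_div (by positivity) (by norm_num), Real.log_rpow hX0, ← hL]
    have hdenL : L ≤ Real.log (X ^ (3 / 2 - τ) / 2) := by rw [hden]; nlinarith
    rw [hnum]
    have hKL : (1.4 + K₁) / L ≤ (1.4 + K₁) * τ := by
      rw [div_eq_mul_inv]; exact mul_le_mul_of_nonneg_left hτL (by positivity)
    calc 3 * ((2 * Real.log 2 + τ * L + K₁) / Real.log (X ^ (3 / 2 - τ) / 2))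
        ≤ 3 * ((1.4 + τ * L + K₁) / L) := by
          gcongr 3 * ?_
          exact div_le_div₀ (by positivity) (by linarith) hL0 hdenL
      _ = 3 * ((1.4 + K₁) / L) + 3 * τ := by field_simp; ring
      _ ≤ 3 * ((1.4 + K₁) * τ) + 3 * τ := by linarith
      _ ≤ 3 * (3 + K₁) * τ := by nlinarith
  -- the degree `≥ 2` primes of `ℬ`
  have hbad : (Real.sqrt (2 * X ^ (3 / 2 : ℝ)) + 1) / X ^ (3 / 2 - τ) ≤ 3 * X ^ (-(1 / 4 : ℝ)) := by
    have h34 : 0 < X ^ (3 / 4 : ℝ) := Real.rpow_pos_of_pos hX0 _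
    have hsq : Real.sqrt (2 * X ^ (3 / 2 : ℝ)) ≤ 2 * X ^ (3 / 4 : ℝ) := by
      rw [Real.sqrt_le_iff]
      refine ⟨by positivity, ?_⟩
      have : (2 * X ^ (3 / 4 : ℝ)) ^ 2 = 4 * X ^ (3 / 2 : ℝ) := by
        rw [mul_pow, ← Real.rpow_natCast (X ^ (3 / 4 : ℝ)) 2, ← Real.rpow_mul hX0.le]; norm_num
      rw [this]; linarith
    have h1 : 1 ≤ X ^ (3 / 4 : ℝ) := Real.one_le_rpow hX1.le (by norm_num)
    have hpos : 0 < X ^ (3 / 2 - τ) := Real.rpow_pos_of_pos hX0 _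
    rw [div_le_iff₀ hpos]
    have h2' : X ^ (3 / 4 : ℝ) = X ^ (-(1 / 4 : ℝ)) * X ^ (3 / 2 - τ) * X ^ (τ - 1 / 2) := by
      rw [← Real.rpow_add hX0, ← Real.rpow_add hX0]; ring_nf
    have h3 : X ^ (τ - 1 / 2) ≤ 1 := Real.rpow_le_one_of_one_le_of_nonpos hX1.le (by linarith)
    have h4' : 0 ≤ X ^ (-(1 / 4 : ℝ)) * X ^ (3 / 2 - τ) := by positivity
    calc Real.sqrt (2 * X ^ (3 / 2 : ℝ)) + 1 ≤ 3 * X ^ (3 / 4 : ℝ) := by linarith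
      _ = 3 * (X ^ (-(1 / 4 : ℝ)) * X ^ (3 / 2 - τ) * X ^ (τ - 1 / 2)) := by rw [← h2']
      _ ≤ 3 * (X ^ (-(1 / 4 : ℝ)) * X ^ (3 / 2 - τ) * 1) := by gcongr
      _ = 3 * X ^ (-(1 / 4 : ℝ)) * X ^ (3 / 2 - τ) := by ring
  have h := primeRange_piece_le (Wc := 3 * (3 + K₁)) hX hτ8 hη0 hη1 hσ0 hC₇ hCB habs hK hw0 hwP h7A h7B
    hcountB hXa hab hbτ hb2 hm hwin hbad
  rw [S₅, S₅]
  exact h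

/-! ### Assembly: Lemma 3.6 from the corrected Lemma 7.1 -/

/-- **Heath-Brown's Lemma 3.6 follows from (the corrected form of) his Lemma 7.1**: "It is now a
straightforward matter to establish Lemma 3.6" (pp. 41–42). With `τ = (log log X)^{−ϖ}`, `η` in the
range (2.1), `κ = σ₀η(3X)^{-1}`: the pieces `S₃, S₅` are single-prime ranges of logarithmic length
`≍ τ` (`S₃_piece_le`, `S₅_piece_le`), the pieces `S₆, S₇` are `U`-pieces whose reciprocal sums are
`≪ τ` (`S₆_piece_le`, `S₇_piece_le`); Lemma 7.1 enters through `weightForm_of_normWeighted` with the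
weight `c_K(N(Q))/N(Q)` (`≤ 8^k/N(Q)` on products of `k` distinct first-degree primes), the terms
`X^{2−τ/5}`, `X^{3−τ/5}` and the prime ideals of degree `≥ 2` being absorbed by (2.1) and (2.5)
(`HeathBrownCubicUpperBoundTools.eventually_upperBound_params`). The constant produced depends on
`ϖ` (through Lemma 7.1's), on `σ₀` and on the Mertens and Weber–Landau constants of the tree.
[cite: HeathBrownActa2001, Lemma 3.6] -/
theorem HeathBrown2001_lemma_3_6_of_lemma_7_1 (h71 : HeathBrown2001_lemma_7_1_normWeighted) :
    HeathBrown2001_lemma_3_6 := by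
  classical
  intro σ₀ hσ ϖ hϖ hϖ5
  have hσ0 : 0 ≤ σ₀ := ge_of_tendsto' hσ fun N => (singularProductPartial_pos N).le
  obtain ⟨C, X₇, h7⟩ := h71 ϖ hϖ hϖ5
  obtain ⟨K₁, hK₁, hK⟩ := exists_sum_primes_inv_window_le
  obtain ⟨C_B, hCBpos, hcB⟩ := exists_countB_le
  have hCB : 0 ≤ C_B := hCBpos.le
  obtain ⟨C₇, hC₇def⟩ : ∃ c : ℝ, c = max C 0 := ⟨_, rfl⟩
  have hC₇ : 0 ≤ C₇ := by rw [hC₇def]; exact le_max_right _ _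
  have hCC₇ : C ≤ C₇ := by rw [hC₇def]; exact le_max_left _ _
  -- the constants of the four pieces
  obtain ⟨c₃, hc₃⟩ : ∃ c : ℝ, c = 32 * C₇ * (6 * (3 + K₁)) + 3 * C₇ + 32 / 3 * σ₀ * C₇ * (6 * (3 + K₁)) +
      σ₀ * C₇ + 3 * σ₀ * C_B := ⟨_, rfl⟩
  obtain ⟨c₅, hc₅⟩ : ∃ c : ℝ, c = 32 * C₇ * (3 * (3 + K₁)) + 3 * C₇ + 32 / 3 * σ₀ * C₇ * (3 * (3 + K₁)) +
      σ₀ * C₇ + 3 * σ₀ * C_B := ⟨_, rfl⟩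
  obtain ⟨c₆, hc₆⟩ : ∃ c : ℝ, c = C₇ * 64 * (72 * (1 + K₁) * (2 + K₁)) / (1 / 4) + 3 * C₇ +
      σ₀ * C₇ * 64 * (72 * (1 + K₁) * (2 + K₁)) / (3 * (1 / 4)) + σ₀ * C₇ + σ₀ * C_B * 90 / 3 := ⟨_, rfl⟩
  obtain ⟨c₇, hc₇⟩ : ∃ c : ℝ, c = C₇ * 512 * ((24 * (1 + K₁)) ^ 2 * (24 * (4 + K₁))) / (3 / 16) + 3 * C₇ +
      σ₀ * C₇ * 512 * ((24 * (1 + K₁)) ^ 2 * (24 * (4 + K₁))) / (3 * (3 / 16)) + σ₀ * C₇ +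
      σ₀ * C_B * 972 / 3 := ⟨_, rfl⟩
  have hc₃0 : 0 ≤ c₃ := by rw [hc₃]; positivity
  have hc₅0 : 0 ≤ c₅ := by rw [hc₅]; positivity
  have hc₆0 : 0 ≤ c₆ := by rw [hc₆]; positivity
  have hc₇0 : 0 ≤ c₇ := by rw [hc₇]; positivity
  -- the parameters, eventually
  have hev := eventually_upperBound_params hϖ (by linarith : ϖ ≤ 1) one_pos 3
  obtain ⟨X₁, hX₁⟩ := Filter.eventually_atTop.mp
    (hev.and ((eventually_ge_atTop X₇).and (eventually_ge_atTop ((2 : ℝ) ^ 15))))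
  refine ⟨c₃ + c₅ + c₆ + c₇, X₁, fun X η hX hηexp hη1 => ?_⟩
  obtain ⟨⟨-, hτ0, hτ8, hτL, habs1⟩, hX7, hX15⟩ := hX₁ X hX
  set τ := hbTau ϖ X with hτdef
  have hX16 : 16 ≤ X := le_trans (by norm_num) hX15
  have hX1 : 1 < X := by linarith
  have hX0 : 0 < X := by linarith
  have hL0 : 0 < Real.log X := by linarith [ten_le_log hX15]
  have hη0 : 0 < η := (Real.exp_pos _).trans_le hηexp
  -- absorption inequality with `η`
  have habs : X ^ (-τ / 5) * Real.log X ^ 3 ≤ τ * η ^ 2 / Real.log X := by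
    have h1 : Real.exp (-2 * Real.log X ^ (1 / 3 : ℝ)) ≤ η ^ 2 := by
      have h2 : Real.exp (-2 * Real.log X ^ (1 / 3 : ℝ)) = Real.exp (-Real.log X ^ (1 / 3 : ℝ)) ^ 2 := by
        rw [← Real.exp_nat_mul]; ring_nf
      rw [h2]
      exact pow_le_pow_left₀ (Real.exp_pos _).le hηexp 2
    calc X ^ (-τ / 5) * Real.log X ^ 3 = 1 * X ^ (-τ / 5) * Real.log X ^ 3 := by ring
      _ ≤ τ * Real.exp (-2 * Real.log X ^ (1 / 3 : ℝ)) / Real.log X := habs1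
      _ ≤ τ * η ^ 2 / Real.log X := by
          rw [mul_div_assoc, mul_div_assoc]
          exact mul_le_mul_of_nonneg_left (div_le_div_of_nonneg_right h1 hL0.le) hτ0.le
  -- the weight `c_K(N Q)/N Q`
  obtain ⟨w, hw⟩ : ∃ w : Ideal (𝓞 K) → ℝ, w = fun Q =>
      (idealNormCount K (Ideal.absNorm Q) : ℝ) * ((Ideal.absNorm Q : ℕ) : ℝ)⁻¹ := ⟨_, rfl⟩
  have hw0 : ∀ Q, 0 ≤ w Q := fun Q => by rw [hw]; positivity
  have hwP : ∀ P : Ideal (𝓞 K), (Ideal.absNorm P).Prime → w P ≤ 8 * ((Ideal.absNorm P : ℕ) : ℝ)⁻¹ :=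
    fun P hp => by rw [hw]; exact normWeight_prime_le hp
  have hwU : ∀ (n : ℕ) (t : Finset (Ideal (𝓞 K)) × Ideal (𝓞 K)), t ∈ Upairs X τ n → UGood t →
      w (uIdeal t) ≤ 8 ^ (n + 1) * ((Ideal.absNorm (uIdeal t) : ℕ) : ℝ)⁻¹ :=
    fun n t ht hg => by rw [hw]; exact normWeight_uIdeal_le ht hg
  -- Lemma 7.1 at this `X, η`, in weighted form
  have h7X := h7 X η hX7 hηexp hη1
  have hminge : ∀ N z : ℝ, X ^ τ ≤ z → 0 < N → N ≤ X ^ (2 - 2 * τ) → 1 ≤ min z (X ^ (2 - τ) / N) := by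
    intro N z hz hN hNX
    have hXτ : 1 ≤ X ^ τ := Real.one_le_rpow hX1.le hτ0.le
    refine le_min (hXτ.trans hz) ?_
    rw [le_div_iff₀ hN, one_mul]
    calc N ≤ X ^ (2 - 2 * τ) := hNX
      _ ≤ X ^ (2 - τ) := Real.rpow_le_rpow_of_exponent_le hX1.le (by linarith)
  have h7A : ∀ (N z : ℝ) (𝒮 : Finset (Ideal (𝓞 K))), X ^ τ ≤ z → 0 < N → N ≤ X ^ (2 - 2 * τ) →
      (∀ Q ∈ 𝒮, Squarefree (Ideal.absNorm Q) ∧ N < (Ideal.absNorm Q : ℝ) ∧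
        (Ideal.absNorm Q : ℝ) ≤ 2 * N) →
      ∑ Q ∈ 𝒮, (siftedA X η Q z : ℝ) ≤
        C₇ * (η ^ 2 * X ^ 2 / Real.log (min z (X ^ (2 - τ) / N)) * ∑ Q ∈ 𝒮, w Q + X ^ (2 - τ / 5)) := by
    intro N z 𝒮 hz hN hNX hmem
    rw [hw]
    refine weightForm_of_normWeighted (S := fun Q => (siftedA X η Q z : ℝ)) (fun Q => Nat.cast_nonneg _)
      hC₇ (by positivity) (fun N' hN' hN'X => hminge N' z hz hN' hN'X) (fun N' 𝒬 hN' hN'X h𝒬 => ?_)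
      N 𝒮 hN hNX hmem
    have hl : 0 ≤ Real.log (min z (X ^ (2 - τ) / N')) := Real.log_nonneg (hminge N' z hz hN' hN'X)
    have hbr : 0 ≤ η ^ 2 * X ^ 2 / Real.log (min z (X ^ (2 - τ) / N')) *
        ∑ Q ∈ normIn 𝒬, ((Ideal.absNorm Q : ℕ) : ℝ)⁻¹ + X ^ (2 - τ / 5) :=
      add_nonneg (mul_nonneg (div_nonneg (by positivity) hl) (sum_nonneg fun _ _ => by positivity))
        (by positivity)
    exact (h7X N' z 𝒬 hz hN' hN'X h𝒬).1.trans (mul_le_mul_of_nonneg_right hCC₇ hbr)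
  have h7B : ∀ (N z : ℝ) (𝒮 : Finset (Ideal (𝓞 K))), X ^ τ ≤ z → 0 < N → N ≤ X ^ (2 - 2 * τ) →
      (∀ Q ∈ 𝒮, Squarefree (Ideal.absNorm Q) ∧ N < (Ideal.absNorm Q : ℝ) ∧
        (Ideal.absNorm Q : ℝ) ≤ 2 * N) →
      ∑ Q ∈ 𝒮, (siftedB X η Q z : ℝ) ≤
        C₇ * (η * X ^ 3 / Real.log (min z (X ^ (2 - τ) / N)) * ∑ Q ∈ 𝒮, w Q + X ^ (3 - τ / 5)) := by
    intro N z 𝒮 hz hN hNX hmem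
    rw [hw]
    refine weightForm_of_normWeighted (S := fun Q => (siftedB X η Q z : ℝ)) (fun Q => Nat.cast_nonneg _)
      hC₇ (by positivity) (fun N' hN' hN'X => hminge N' z hz hN' hN'X) (fun N' 𝒬 hN' hN'X h𝒬 => ?_)
      N 𝒮 hN hNX hmem
    have hl : 0 ≤ Real.log (min z (X ^ (2 - τ) / N')) := Real.log_nonneg (hminge N' z hz hN' hN'X)
    have hbr : 0 ≤ η * X ^ 3 / Real.log (min z (X ^ (2 - τ) / N')) *
        ∑ Q ∈ normIn 𝒬, ((Ideal.absNorm Q : ℕ) : ℝ)⁻¹ + X ^ (3 - τ / 5) :=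
      add_nonneg (mul_nonneg (div_nonneg (by positivity) hl) (sum_nonneg fun _ _ => by positivity))
        (by positivity)
    exact (h7X N' z 𝒬 hz hN' hN'X h𝒬).2.trans (mul_le_mul_of_nonneg_right hCC₇ hbr)
  have hcountB : ∀ R : Ideal (𝓞 K), R ≠ ⊥ → (countB X η R : ℝ) ≤ C_B * X ^ 3 / Ideal.absNorm R :=
    hcB X η hX0.le hη0.le hη1
  -- the four pieces
  have h3 := S₃_piece_le hX15 hτ0 hτ8 hτL hη0 hη1 hσ0 hC₇ hCB hK₁ habs hK hw0 hwP h7A h7B hcountB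
  have h5 := S₅_piece_le hX15 hτ0 hτ8 hτL hη0 hη1 hσ0 hC₇ hCB hK₁ habs hK hw0 hwP h7A h7B hcountB
  have h6 := S₆_piece_le hX15 hτ0 hτ8 hτL hη0 hη1 hσ0 hC₇ hCB hK₁ habs hK hw0 hwU h7A h7B hcountB
  have h7' := S₇_piece_le hX15 hτ0 hτ8 hτL hη0 hη1 hσ0 hC₇ hCB hK₁ habs hK hw0 hwU h7A h7B hcountB
  rw [← hc₃] at h3
  rw [← hc₅] at h5
  rw [← hc₆] at h6
  rw [← hc₇] at h7'
  have hB : 0 ≤ τ * η ^ 2 * X ^ 2 / Real.log X := by positivity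
  have key : ∀ {S c : ℝ}, S ≤ c * (τ * η ^ 2 * X ^ 2 / Real.log X) → c ≤ c₃ + c₅ + c₆ + c₇ →
      S ≤ (c₃ + c₅ + c₆ + c₇) * hbTau ϖ X * η ^ 2 * X ^ 2 / Real.log X := by
    intro S c hS hc
    calc S ≤ c * (τ * η ^ 2 * X ^ 2 / Real.log X) := hS
      _ ≤ (c₃ + c₅ + c₆ + c₇) * (τ * η ^ 2 * X ^ 2 / Real.log X) := mul_le_mul_of_nonneg_right hc hB
      _ = _ := by rw [hτdef]; ring
  exact ⟨key h3 (by linarith), key h5 (by linarith), key h6 (by linarith), key h7' (by linarith)⟩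

/-- **parity.S18 from Lemma 3.5, the corrected Lemma 7.1 and Lemmas 3.7–3.10 of Heath-Brown's paper**
— the frontier after this file: Landau's prime ideal theorem is proved in the tree
(`Literature.NumberTheory.LFunctions.NumberField.primeIdealTheorem_holds`) and Lemma 3.6 is supplied by
`HeathBrown2001_lemma_3_6_of_lemma_7_1`. [cite: HeathBrownActa2001, Theorem (p. 2)] -/
theorem _root_.Literature.NumberTheory.Sieve.setOf_prime_cube_add_two_mul_cube_infinite_of_lemma_7_1
    (h35 : HeathBrown2001_lemma_3_5) (h71 : HeathBrown2001_lemma_7_1_normWeighted)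
    (h37 : HeathBrown2001_lemma_3_7) (h38 : HeathBrown2001_lemma_3_8) (h39 : HeathBrown2001_lemma_3_9)
    (h310 : HeathBrown2001_lemma_3_10) :
    Literature.NumberTheory.Sieve.setOf_prime_cube_add_two_mul_cube_infinite :=
  Literature.NumberTheory.Sieve.setOf_prime_cube_add_two_mul_cube_infinite_of_lemmas
    Literature.NumberTheory.LFunctions.NumberField.primeIdealTheorem_holds h35
    (HeathBrown2001_lemma_3_6_of_lemma_7_1 h71) h37 h38 h39 h310

end Literature.NumberTheory.Sieve.CubicSieve

end
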